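import Literature.Topology.FourManifolds.BandCore
import Literature.Topology.FourManifolds.BandRebuildCurve
import Literature.Topology.FourManifolds.SchubertNormalForm
import Literature.Topology.FourManifolds.PreBandData
import HarnessLib

/-!
# Rebuilding a knot along a band core: every band core is the band of a band sum

Topic `Literature/Topology/FourManifolds` (trunk T-4MAN); fact seat
`provefact-Literature.Topology.FourManifolds.Knot.exists_isBandSum` (`BandSum.lean`: existence of
band sums; Gompf–Stipsicz (1999), §5.1, Fig. 5.7; Kirby (1989), Ch. I §4, p. 10). Continuation of
`BandCore.lean` (see its module docstring): Parts III–V of the tree's rebuild pipeline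
(`BandRebuildCurve.lean` and Part V of `SchubertNormalForm.lean`) **re-run verbatim over a band
core** `b : BandCore A B avoid` (the band of a band sum without the result knot) in place of full
band-sum data `BandData A B K avoid`, which is possible because the pipeline only reads the band.
Statements, names (namespace `BandCore`) and proofs are those of the tree files; the root-level
`exists_reparam` (`BandRebuildCurve.lean`) and `exists_circlePt_eq` (`SchubertNormalForm.lean`) are
imported, not repeated.

## Part III: the rebuilt closed curve and knot

`b.rebuildCurve : ℝ → ℝ⁴`, the `1`-periodic curve which on the fundamental domain
`[alo, alo + 1)` is `band (cLo t)` on `[alo, tlo)` (lower arch), `B (circlePt (psi t))` on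
`[tlo, thi)`, `band (cUp t)` on `[thi, ahi)` (upper arch) and `A (circlePt t)` on `[ahi, alo + 1)`:
`C^∞` (junction lemmas), regular, on the unit sphere, and — for disjoint `A`, `B` — injective
modulo the period; hence (`KnotOfClosedCurve.lean`) the **rebuilt knot** `b.rebuild hAB : Knot`.

## Part IV: the standard arcs

`b.loArc`, `b.upArc`: the arches over the stretch where their heights climb from `-δ` (descend
from `1 + δ`), reparametrised over `[0, 1]` with the parameter `1/2` at a prescribed interior point;
smoothness, injectivity, regularity, endpoints, membership clauses, midpoints and images.

## Part V: the rebuilt knot is a band sum along the core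

* `Literature.Topology.FourManifolds.BandCore.rebuildData` — `BandData A B (b.rebuild hAB) avoid`:
  the same band map and collar width, the standard arcs, the avoided set carried along (the clause
  `disjoint_avoid` only concerns the band); the clauses are computations of `range (b.rebuild hAB)`
  against the band (`preimage_range_rebuild`, `range_diff_rebuild`, `orient_result_rebuild`);
* `Literature.Topology.FourManifolds.BandCore.isBandSum_rebuild`,
  `Literature.Topology.FourManifolds.BandCore.exists_isBandSum` — **every band core between disjoint
  knots is the band of a band sum**: `∃ K, Knot.IsBandSum A B K avoid`.

* `Literature.Topology.FourManifolds.PreBandData.toCore`,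
  `Literature.Topology.FourManifolds.PreBandData.exists_isBandSum` — the same for the tree's
  `PreBandData` (`PreBandData.lean`, the identical `K`-free structure introduced in parallel for the
  same fact seat): its eleven fields are those of `BandCore`, so pre-band data between disjoint
  knots are likewise the band of a band sum.

So the existence of band sums (`Knot.exists_isBandSum`) is reduced to the existence of a band
core (equivalently, of pre-band data). Everything here is proved; no named facts are introduced
(D-0026).

## References

* R. E. Gompf, A. I. Stipsicz, *4-Manifolds and Kirby Calculus*, GSM 20, AMS (1999), §5.1,
  Fig. 5.7. [GompfStipsicz1999]
* R. C. Kirby, *The Topology of 4-Manifolds*, LNM 1374, Springer (1989), Ch. I §4, p. 10 (held: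
  `book:kirby1989-topology-4-manifolds`, PDF p. 10). [Kirby1989]
* P. R. Cromwell, *Knots and Links*, Cambridge University Press (2004), §4.6 (held:
  `book:cromwell2004-knots-links`, PDF p. 69). [Cromwell2004]
-/

open scoped Manifold ContDiff Topology Real
open Function Set Metric

noncomputable section

namespace Literature.Topology.FourManifolds

/-- Local notation: `𝔼 n` is the model Euclidean space `EuclideanSpace ℝ (Fin n)`. -/
local notation "𝔼 " n:arg => EuclideanSpace ℝ (Fin n)

/-- Local notation: `𝕊 n` is the unit sphere in `EuclideanSpace ℝ (Fin (n + 1))`. -/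
local notation "𝕊 " n:arg => (Metric.sphere (0 : EuclideanSpace ℝ (Fin (n + 1))) 1)

namespace BandCore

variable {A B : Knot} {avoid : Set (𝕊 3)} (b : BandCore A B avoid)

/-! ### The four pieces and the reduction of the parameter -/

/-- The rebuilt curve on the fundamental domain `[alo, alo + 1)` (junk elsewhere): lower arch,
`B`, upper arch, `A`. [folklore] -/
def pieceFun (t : ℝ) : 𝔼 4 :=
  if t < b.tlo then ((b.band (b.cLo t) : 𝕊 3) : 𝔼 4)
  else if t < b.thi then Knot.curve B (b.psi t)
  else if t < b.ahi then ((b.band (b.cUp t) : 𝕊 3) : 𝔼 4)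
  else Knot.curve A t

/-- Reduction of the parameter into the fundamental domain `[alo, alo + 1)`. [folklore] -/
def red (t : ℝ) : ℝ := toIcoMod zero_lt_one b.alo t

/-- **The rebuilt curve** `ℝ → ℝ⁴` (`1`-periodic). [folklore] -/
def rebuildCurve (t : ℝ) : 𝔼 4 := b.pieceFun (b.red t)

/-- The reduced parameter lies in the fundamental domain. [folklore] -/
theorem red_mem (t : ℝ) : b.red t ∈ Ico b.alo (b.alo + 1) := toIcoMod_mem_Ico _ _ _

/-- The reduced parameter differs from the parameter by an integer. [folklore] -/
theorem exists_red_eq (t : ℝ) : ∃ n : ℤ, b.red t = t - n := by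
  refine ⟨toIcoDiv zero_lt_one b.alo t, ?_⟩
  have h := self_sub_toIcoDiv_zsmul zero_lt_one b.alo t
  rw [zsmul_eq_mul, mul_one] at h
  exact h.symm

/-- The reduction is `1`-periodic. [folklore] -/
theorem red_add_one (t : ℝ) : b.red (t + 1) = b.red t := toIcoMod_add_right _ _ _

/-- On the window `(alo + n, alo + n + 1)` the reduction is `t ↦ t - n`. [folklore] -/
theorem red_eq_sub {t : ℝ} {n : ℤ} (ht : t - n ∈ Ico b.alo (b.alo + 1)) : b.red t = t - n := by
  rw [red, toIcoMod_eq_iff]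
  exact ⟨ht, n, by simp⟩

/-- Two parameters have the same reduction iff they differ by an integer. [folklore] -/
theorem red_eq_red_iff {s t : ℝ} : b.red s = b.red t ↔ ∃ n : ℤ, t - s = n := by
  rw [red, red, toIcoMod_eq_toIcoMod zero_lt_one]
  simp

/-- The rebuilt curve is `1`-periodic. [folklore] -/
theorem periodic_rebuildCurve : Periodic b.rebuildCurve 1 := fun t ↦ by
  rw [rebuildCurve, rebuildCurve, red_add_one]

/-- Values of the four pieces. [folklore] -/
theorem pieceFun_of_lt_tlo {t : ℝ} (ht : t < b.tlo) : b.pieceFun t = ((b.band (b.cLo t) : 𝕊 3) : 𝔼 4) := by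
  simp [pieceFun, ht]

/-- Values of the four pieces. [folklore] -/
theorem pieceFun_of_tlo_le {t : ℝ} (h1 : b.tlo ≤ t) (h2 : t < b.thi) :
    b.pieceFun t = Knot.curve B (b.psi t) := by
  simp [pieceFun, not_lt.2 h1, h2]

/-- Values of the four pieces. [folklore] -/
theorem pieceFun_of_thi_le {t : ℝ} (h1 : b.thi ≤ t) (h2 : t < b.ahi) :
    b.pieceFun t = ((b.band (b.cUp t) : 𝕊 3) : 𝔼 4) := by
  have h0 : ¬ t < b.tlo := not_lt.2 (b.marks_lt.2.2.2.1.le.trans h1)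
  simp [pieceFun, h0, not_lt.2 h1, h2]

/-- Values of the four pieces. [folklore] -/
theorem pieceFun_of_ahi_le {t : ℝ} (h1 : b.ahi ≤ t) : b.pieceFun t = Knot.curve A t := by
  have hm := b.marks_lt
  have h0 : ¬ t < b.tlo := not_lt.2 (by linarith)
  have h0' : ¬ t < b.thi := not_lt.2 (by linarith)
  simp [pieceFun, h0, h0', not_lt.2 h1]

/-- The rebuilt curve lies on the unit sphere. [folklore] -/
theorem norm_rebuildCurve (t : ℝ) : ‖b.rebuildCurve t‖ = 1 := by
  rw [rebuildCurve, pieceFun]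
  split_ifs
  · exact norm_eq_of_mem_sphere _
  · exact Knot.norm_curve B _
  · exact norm_eq_of_mem_sphere _
  · exact Knot.norm_curve A _

/-! ### Local representations of the rebuilt curve -/

/-- The junction at `tlo` extended: on `(tlo - epsLo, thi)` the piece function is
`B ∘ circlePt ∘ psi`. [folklore] -/
theorem pieceFun_eq_B {t : ℝ} (ht : t ∈ Ioo (b.tlo - b.epsLo) b.thi) :
    b.pieceFun t = Knot.curve B (b.psi t) := by
  rcases lt_or_ge t b.tlo with h | h
  · rw [b.pieceFun_of_lt_tlo h, Knot.curve_apply, b.band_cLo_eq_B ⟨ht.1.le, ?_⟩]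
    exact h.le.trans b.tlo_marksB.1.le
  · exact b.pieceFun_of_tlo_le h ht.2

/-- The junction at `thi` extended: on `[tlo, thi + epsHi)` the piece function is
`B ∘ circlePt ∘ psi`. [folklore] -/
theorem pieceFun_eq_B' {t : ℝ} (ht : t ∈ Ico b.tlo (b.thi + b.epsHi)) :
    b.pieceFun t = Knot.curve B (b.psi t) := by
  have hm := b.marks_lt
  obtain ⟨hε, hε1, -⟩ := b.epsHi_bounds
  rcases lt_or_ge t b.thi with h | h
  · exact b.pieceFun_of_tlo_le ht.1 h
  · rw [b.pieceFun_of_thi_le h (by linarith [ht.2]), Knot.curve_apply,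
      b.band_cUp_eq_B ⟨?_, ht.2.le⟩]
    exact (b.thi_marksB.1.le).trans h

/-- The junction at `ahi` extended: on `[thi + epsHi, ∞) ∩ (ahi - epsHi, ∞)`... precisely on
`(ahi - epsHi, alo + 1)` the piece function is `A ∘ circlePt`. [folklore] -/
theorem pieceFun_eq_A {t : ℝ} (ht : t ∈ Ioo (b.ahi - b.epsHi) (b.alo + 1)) :
    b.pieceFun t = Knot.curve A t := by
  have hm := b.marks_lt
  obtain ⟨hε, hε1, -⟩ := b.epsHi_bounds
  rcases lt_or_ge t b.ahi with h | h
  · rw [b.pieceFun_of_thi_le (by linarith [ht.1]) h, Knot.curve_apply, b.band_cUp_eq_A ⟨ht.1.le, ?_⟩]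
    linarith
  · exact b.pieceFun_of_ahi_le h

/-- The junction at `alo` (wrap point): on `[alo, alo + epsLo)` the piece function is
`A ∘ circlePt`. [folklore] -/
theorem pieceFun_eq_A' {t : ℝ} (ht : t ∈ Ico b.alo (b.alo + b.epsLo)) :
    b.pieceFun t = Knot.curve A t := by
  have hm := b.marks_lt
  obtain ⟨hε, hε1, -⟩ := b.epsLo_bounds
  rw [b.pieceFun_of_lt_tlo (by linarith [ht.2]), Knot.curve_apply, b.band_cLo_eq_A ⟨by linarith [ht.1], ht.2.le⟩]

/-- **Local representations.** Near every parameter the rebuilt curve agrees with one of the four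
smooth model maps precomposed with an integer translation: `A ∘ circlePt`, `band ∘ cLo` (at reduced
parameters in `(alo, tlo)`), `B ∘ circlePt ∘ psi`, or `band ∘ cUp` (reduced parameters in
`(thi, ahi)`). [folklore] -/
theorem exists_local_rep (t₀ : ℝ) :
    (∃ n : ℤ, b.rebuildCurve =ᶠ[𝓝 t₀] fun t ↦ Knot.curve A (t - n)) ∨
    (∃ n : ℤ, t₀ - n ∈ Ioo b.alo b.tlo ∧
      b.rebuildCurve =ᶠ[𝓝 t₀] fun t ↦ ((b.band (b.cLo (t - n)) : 𝕊 3) : 𝔼 4)) ∨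
    (∃ n : ℤ, b.rebuildCurve =ᶠ[𝓝 t₀] fun t ↦ Knot.curve B (b.psi (t - n))) ∨
    (∃ n : ℤ, t₀ - n ∈ Ioo b.thi b.ahi ∧
      b.rebuildCurve =ᶠ[𝓝 t₀] fun t ↦ ((b.band (b.cUp (t - n)) : 𝕊 3) : 𝔼 4)) := by
  have hm := b.marks_lt
  obtain ⟨hε, hε1, -⟩ := b.epsLo_bounds
  obtain ⟨hε', hε1', -⟩ := b.epsHi_bounds
  obtain ⟨n, hn⟩ := b.exists_red_eq t₀
  have hr := b.red_mem t₀
  rw [hn] at hr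
  rcases hr.1.eq_or_lt with heq | hlt
  · -- the wrap point `t₀ = alo + n`: the curve is `A` on both sides
    left
    refine ⟨n, ?_⟩
    have hwin : Ioo (b.alo + n - b.epsHi) (b.alo + n + b.epsLo) ∈ 𝓝 t₀ :=
      isOpen_Ioo.mem_nhds ⟨by linarith, by linarith⟩
    filter_upwards [hwin] with t ht
    rcases lt_or_ge (t - n) b.alo with h | h
    · -- left of the wrap point: reduced parameter `t - n + 1 ∈ (alo + 1 - epsHi, alo + 1)`
      have hred : b.red t = t - (n - 1 : ℤ) := b.red_eq_sub (by
        push_cast; exact ⟨by linarith [ht.1], by linarith⟩)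
      rw [rebuildCurve, hred, b.pieceFun_eq_A ⟨by push_cast; linarith [ht.1], by push_cast; linarith⟩]
      push_cast
      rw [show t - (↑n - 1) = t - n + 1 by ring]
      exact Knot.periodic_curve A _
    · have hred : b.red t = t - n := b.red_eq_sub ⟨h, by linarith [ht.2]⟩
      rw [rebuildCurve, hred, b.pieceFun_eq_A' ⟨h, by linarith [ht.2]⟩]
  -- generic point: `red t = t - n` on the window `(alo + n, alo + n + 1) ∋ t₀`
  have hev : ∀ᶠ t : ℝ in 𝓝 t₀, b.red t = t - n := by
    have hwin : Ioo (b.alo + n) (b.alo + n + 1) ∈ 𝓝 t₀ := isOpen_Ioo.mem_nhds ⟨by linarith, by linarith [hr.2]⟩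
    filter_upwards [hwin] with t ht
    exact b.red_eq_sub ⟨by linarith [ht.1], by linarith [ht.2]⟩
  rcases lt_or_ge (t₀ - n) b.tlo with h1 | h1
  · -- lower arch region `(alo, tlo)`
    right; left
    refine ⟨n, ⟨hlt, h1⟩, ?_⟩
    have hwin : Iio (b.tlo + n) ∈ 𝓝 t₀ := isOpen_Iio.mem_nhds (by show t₀ < b.tlo + n; linarith)
    filter_upwards [hev, hwin] with t ht ht'
    rw [rebuildCurve, ht, b.pieceFun_of_lt_tlo (by simp only [mem_Iio] at ht'; linarith)]
  rcases lt_or_ge (t₀ - n) b.thi with h2 | h2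
  · -- `B` region, with the overlap `(tlo - epsLo, thi)`
    right; right; left
    refine ⟨n, ?_⟩
    have hwin : Ioo (b.tlo - b.epsLo + n) (b.thi + n) ∈ 𝓝 t₀ := isOpen_Ioo.mem_nhds ⟨by linarith, by linarith⟩
    filter_upwards [hev, hwin] with t ht ht'
    rw [rebuildCurve, ht, b.pieceFun_eq_B ⟨by linarith [ht'.1], by linarith [ht'.2]⟩]
  rcases eq_or_lt_of_le h2 with h3 | h3
  · -- the junction point `thi`: `B` on both sides
    right; right; left
    refine ⟨n, ?_⟩
    have hwin : Ioo (b.tlo - b.epsLo + n) (b.thi + b.epsHi + n) ∈ 𝓝 t₀ :=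
      isOpen_Ioo.mem_nhds ⟨by linarith, by linarith⟩
    filter_upwards [hev, hwin] with t ht ht'
    rw [rebuildCurve, ht]
    rcases lt_or_ge (t - n) b.tlo with h4 | h4
    · exact b.pieceFun_eq_B ⟨by linarith [ht'.1], by linarith⟩
    · exact b.pieceFun_eq_B' ⟨h4, by linarith [ht'.2]⟩
  rcases lt_or_ge (t₀ - n) b.ahi with h4 | h4
  · -- upper arch region `(thi, ahi)`
    right; right; right
    refine ⟨n, ⟨h3, h4⟩, ?_⟩
    have hwin : Ioo (b.thi + n) (b.ahi + n) ∈ 𝓝 t₀ := isOpen_Ioo.mem_nhds ⟨by linarith, by linarith⟩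
    filter_upwards [hev, hwin] with t ht ht'
    rw [rebuildCurve, ht, b.pieceFun_of_thi_le (by linarith [ht'.1]) (by linarith [ht'.2])]
  · -- `A` region `[ahi, alo + 1)`, with the overlap `(ahi - epsHi, alo + 1)`
    left
    refine ⟨n, ?_⟩
    have hwin : Ioo (b.ahi - b.epsHi + n) (b.alo + 1 + n) ∈ 𝓝 t₀ :=
      isOpen_Ioo.mem_nhds ⟨by linarith, by linarith [hr.2]⟩
    filter_upwards [hev, hwin] with t ht ht'
    rw [rebuildCurve, ht, b.pieceFun_eq_A ⟨by linarith [ht'.1], by linarith [ht'.2]⟩]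

/-! ### Smoothness and regularity -/

/-- **The rebuilt curve is `C^∞`.** [folklore] -/
theorem contDiff_rebuildCurve : ContDiff ℝ ∞ b.rebuildCurve := by
  rw [contDiff_iff_contDiffAt]
  intro t₀
  have hsh : ∀ n : ℤ, ContDiff ℝ ∞ fun t : ℝ ↦ t - n := fun n ↦ contDiff_id.sub contDiff_const
  rcases b.exists_local_rep t₀ with ⟨n, h⟩ | ⟨n, -, h⟩ | ⟨n, h⟩ | ⟨n, -, h⟩
  · exact ((Knot.contDiff_curve A).comp (hsh n)).contDiffAt.congr_of_eventuallyEq h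
  · exact (b.contDiff_coe_band.comp (b.cLo_spec.1.comp (hsh n))).contDiffAt.congr_of_eventuallyEq h
  · exact ((Knot.contDiff_curve B).comp (b.contDiff_psi.comp (hsh n))).contDiffAt.congr_of_eventuallyEq h
  · exact (b.contDiff_coe_band.comp (b.contDiff_cUp.comp (hsh n))).contDiffAt.congr_of_eventuallyEq h

/-- The rebuilt curve is continuous. [folklore] -/
theorem continuous_rebuildCurve : Continuous b.rebuildCurve := b.contDiff_rebuildCurve.continuous

/-- The velocity of the band image of a regular planar curve inside the square is nonzero.
[folklore] -/
theorem deriv_coe_band_comp_ne_zero {c : ℝ → 𝔼 2} {s : ℝ} (hc : DifferentiableAt ℝ c s)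
    (hU : c s ∈ squareNhd b.δ) (hc' : deriv c s ≠ 0) :
    deriv (fun t ↦ ((b.band (c t) : 𝕊 3) : 𝔼 4)) s ≠ 0 := by
  have hd : HasDerivAt (fun t ↦ ((b.band (c t) : 𝕊 3) : 𝔼 4))
      (fderiv ℝ (fun x ↦ ((b.band x : 𝕊 3) : 𝔼 4)) (c s) (deriv c s)) s :=
    ((b.contDiff_coe_band.differentiable (by simp)) (c s)).hasFDerivAt.comp_hasDerivAt s hc.hasDerivAt
  rw [hd.deriv]
  exact b.fderiv_coe_band_ne_zero hU hc'

/-- **The rebuilt curve is regular.** [folklore] -/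
theorem deriv_rebuildCurve_ne_zero (t₀ : ℝ) : deriv b.rebuildCurve t₀ ≠ 0 := by
  -- derivative of a shifted map `t ↦ F (t - n)`
  have shift : ∀ {F : ℝ → 𝔼 4} {n : ℤ}, DifferentiableAt ℝ F (t₀ - n) →
      deriv (fun t ↦ F (t - n)) t₀ = deriv F (t₀ - n) := fun {F n} hF ↦ by
    have h1 : HasDerivAt (fun t : ℝ ↦ t - n) 1 t₀ := (hasDerivAt_id t₀).sub_const _
    have h2 : HasDerivAt (fun t ↦ F (t - n)) ((1 : ℝ) • deriv F (t₀ - n)) t₀ := hF.hasDerivAt.scomp t₀ h1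
    rw [h2.deriv, one_smul]
  rcases b.exists_local_rep t₀ with ⟨n, h⟩ | ⟨n, hn, h⟩ | ⟨n, h⟩ | ⟨n, hn, h⟩
  · rw [h.deriv_eq, shift (((Knot.contDiff_curve A).differentiable (by simp)) _)]
    exact Knot.deriv_curve_ne_zero A _
  · rw [h.deriv_eq, shift (F := fun s ↦ ((b.band (b.cLo s) : 𝕊 3) : 𝔼 4))
      (((b.contDiff_coe_band.comp b.cLo_spec.1).differentiable (by simp)) _)]
    exact b.deriv_coe_band_comp_ne_zero ((b.cLo_spec.1.differentiable (by simp)) _)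
      (b.cLo_mem ⟨hn.1.le, hn.2.le⟩).1 (b.cLo_spec.2.2.2.2.2.2.2 _)
  · rw [h.deriv_eq, shift (F := fun s ↦ Knot.curve B (b.psi s))
      ((((Knot.contDiff_curve B).comp b.contDiff_psi).differentiable (by simp)) _)]
    have hd : HasDerivAt (fun s ↦ Knot.curve B (b.psi s)) (b.lam • deriv (Knot.curve B) (b.psi (t₀ - n)))
        (t₀ - n) :=
      (((Knot.contDiff_curve B).differentiable (by simp)) (b.psi (t₀ - n))).hasDerivAt.scomp
        (t₀ - n) (b.hasDerivAt_psi (t₀ - n))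
    rw [hd.deriv]
    exact smul_ne_zero b.lam_pos.ne' (Knot.deriv_curve_ne_zero B _)
  · rw [h.deriv_eq, shift (F := fun s ↦ ((b.band (b.cUp s) : 𝕊 3) : 𝔼 4))
      (((b.contDiff_coe_band.comp b.contDiff_cUp).differentiable (by simp)) _)]
    exact b.deriv_coe_band_comp_ne_zero ((b.contDiff_cUp.differentiable (by simp)) _)
      (b.cUp_mem ⟨hn.1.le, hn.2.le⟩).1 (b.deriv_cUp_ne_zero _)

/-- **The rebuilt curve is a regular closed curve** in the `2π`-periodic normalisation of
`KnotOfClosedCurve.lean`: `θ ↦ rebuildCurve (θ / 2π)`. [folklore] -/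
theorem isRegularClosedCurve_rebuildCurve :
    IsRegularClosedCurve fun θ ↦ b.rebuildCurve ((2 * π)⁻¹ * θ) where
  contDiff := b.contDiff_rebuildCurve.comp (contDiff_const.mul contDiff_id)
  periodic θ := by
    show b.rebuildCurve ((2 * π)⁻¹ * (θ + 2 * π)) = b.rebuildCurve ((2 * π)⁻¹ * θ)
    rw [mul_add, inv_mul_cancel₀ (by positivity), b.periodic_rebuildCurve]
  norm_eq_one θ := b.norm_rebuildCurve _
  deriv_ne_zero θ := by
    rw [deriv_comp_mul_left]
    exact smul_ne_zero (inv_ne_zero (by positivity)) (b.deriv_rebuildCurve_ne_zero _)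

/-! ### Injectivity modulo the period -/

/-- Points of the band off the left edge are not on `A`. [folklore] -/
theorem band_not_mem_range_A {x : 𝔼 2} (hx : x ∈ squareNhd b.δ) (h0 : x 0 ≠ 0) :
    b.band x ∉ range A := fun h ↦ by
  have : x ∈ b.band ⁻¹' range A ∩ squareNhd b.δ := ⟨h, hx⟩
  rw [b.preimage_left] at this
  exact h0 this.2

/-- Points of the band off the right edge are not on `B`. [folklore] -/
theorem band_not_mem_range_B {x : 𝔼 2} (hx : x ∈ squareNhd b.δ) (h1 : x 0 ≠ 1) :
    b.band x ∉ range B := fun h ↦ by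
  have : x ∈ b.band ⁻¹' range B ∩ squareNhd b.δ := ⟨h, hx⟩
  rw [b.preimage_right] at this
  exact h1 this.2

/-- **Type A**: on `[alo, alo + epsLo]` and on `[ahi - epsHi, alo + 1)` the piece function is the
summand `A`. [folklore] -/
theorem pieceFun_typeA {s : ℝ} (hs : s ∈ Ico b.alo (b.alo + 1))
    (h : s ≤ b.alo + b.epsLo ∨ b.ahi - b.epsHi ≤ s) : b.pieceFun s = Knot.curve A s := by
  have hm := b.marks_lt
  obtain ⟨hε, hε1, -⟩ := b.epsLo_bounds
  obtain ⟨hε', hε1', -⟩ := b.epsHi_bounds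
  rcases h with h | h
  · rw [b.pieceFun_of_lt_tlo (by linarith), Knot.curve_apply, b.band_cLo_eq_A ⟨by linarith [hs.1], h⟩]
  · rcases lt_or_ge s b.ahi with h' | h'
    · rw [b.pieceFun_of_thi_le (by linarith) h', Knot.curve_apply, b.band_cUp_eq_A ⟨h, by linarith⟩]
    · exact b.pieceFun_of_ahi_le h'

/-- **Type B**: on `[tlo - epsLo, thi + epsHi]` the piece function is the summand `B` at the
parameter `psi s`. [folklore] -/
theorem pieceFun_typeB {s : ℝ} (h : s ∈ Icc (b.tlo - b.epsLo) (b.thi + b.epsHi)) :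
    b.pieceFun s = Knot.curve B (b.psi s) := by
  have hm := b.marks_lt
  obtain ⟨hε', hε1', -⟩ := b.epsHi_bounds
  rcases lt_or_ge s b.tlo with h1 | h1
  · rw [b.pieceFun_of_lt_tlo h1, Knot.curve_apply, b.band_cLo_eq_B ⟨h.1, h1.le.trans b.tlo_marksB.1.le⟩]
  rcases lt_or_ge s b.thi with h2 | h2
  · exact b.pieceFun_of_tlo_le h1 h2
  · rw [b.pieceFun_of_thi_le h2 (by linarith [h.2]), Knot.curve_apply,
      b.band_cUp_eq_B ⟨b.thi_marksB.1.le.trans h2, h.2⟩]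

/-- **Type O (lower arch)**: on `(alo + epsLo, tlo - epsLo)` the piece function is a band point
strictly inside the square, below height `2/5`, off both summands. [folklore] -/
theorem pieceFun_typeO_lo {s : ℝ} (h : s ∈ Ioo (b.alo + b.epsLo) (b.tlo - b.epsLo)) :
    b.pieceFun s = ((b.band (b.cLo s) : 𝕊 3) : 𝔼 4) ∧ b.cLo s ∈ squareNhd b.δ ∧
      b.cLo s 0 ∈ Ioo (0 : ℝ) 1 ∧ b.cLo s 1 < 2 / 5 ∧
      b.band (b.cLo s) ∉ range A ∧ b.band (b.cLo s) ∉ range B := by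
  obtain ⟨hε, hε1, -⟩ := b.epsLo_bounds
  obtain ⟨hU, h1⟩ := b.cLo_mem (t := s) ⟨by linarith [h.1], by linarith [h.2]⟩
  have h0 := b.cLo_spec.2.2.2.1 s h
  exact ⟨b.pieceFun_of_lt_tlo (by linarith [h.2]), hU, h0, h1.2,
    b.band_not_mem_range_A hU h0.1.ne', b.band_not_mem_range_B hU h0.2.ne⟩

/-- **Type O (upper arch)**: on `(thi + epsHi, ahi - epsHi)` the piece function is a band point
strictly inside the square, above height `3/5`, off both summands. [folklore] -/
theorem pieceFun_typeO_hi {s : ℝ} (h : s ∈ Ioo (b.thi + b.epsHi) (b.ahi - b.epsHi)) :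
    b.pieceFun s = ((b.band (b.cUp s) : 𝕊 3) : 𝔼 4) ∧ b.cUp s ∈ squareNhd b.δ ∧
      b.cUp s 0 ∈ Ioo (0 : ℝ) 1 ∧ 3 / 5 < b.cUp s 1 ∧
      b.band (b.cUp s) ∉ range A ∧ b.band (b.cUp s) ∉ range B := by
  obtain ⟨hε, hε1, -⟩ := b.epsHi_bounds
  obtain ⟨hU, h1⟩ := b.cUp_mem (t := s) ⟨by linarith [h.1], by linarith [h.2]⟩
  have h0 := b.cUp_zero_mem_Ioo h
  exact ⟨b.pieceFun_of_thi_le (by linarith [h.1]) (by linarith [h.2]), hU, h0, h1.1,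
    b.band_not_mem_range_A hU h0.1.ne', b.band_not_mem_range_B hU h0.2.ne⟩

/-- Two parameters of `B` in `[tlo - epsLo, thi + epsHi]` with the same point of `B` are equal:
the stretch `psi ([tlo - epsLo, thi + epsHi])` is shorter than one period. [folklore] -/
theorem eq_of_curve_B_psi_eq {s t : ℝ} (hs : s ∈ Icc (b.tlo - b.epsLo) (b.thi + b.epsHi))
    (ht : t ∈ Icc (b.tlo - b.epsLo) (b.thi + b.epsHi)) (h : Knot.curve B (b.psi s) = Knot.curve B (b.psi t)) :
    s = t := by
  obtain ⟨m, hm⟩ := (Knot.curve_eq_curve_iff B).1 h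
  -- the stretch is shorter than one period
  obtain ⟨-, -, hε2⟩ := b.epsLo_bounds
  obtain ⟨-, -, hε2'⟩ := b.epsHi_bounds
  have hanti := b.strictAntiOn_thetaB
  have h37 : b.thetaB (7 / 10) < b.thetaB (3 / 10) := hanti (by norm_num) (by norm_num) (by norm_num)
  have hlen : b.psi (b.thi + b.epsHi) - b.psi (b.tlo - b.epsLo) < 1 := by
    rw [b.psi_sub_psi]
    have e : (b.thi + b.epsHi - (b.tlo - b.epsLo)) * b.lam =
        (b.thi - b.tlo) * b.lam + (b.epsLo + b.epsHi) * b.lam := by ring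
    have e2 : (b.thi - b.tlo) * b.lam = b.thetaB (4 / 5) + 1 - b.thetaB (1 / 5) := by
      have := b.psi_sub_psi b.tlo b.thi
      rw [psi_thi, psi_tlo] at this
      linarith
    rw [e, e2]
    have hst := b.thetaB_stretch.2
    nlinarith
  have hmono := b.strictMono_psi.monotone
  have h1 : |b.psi s - b.psi t| < 1 := by
    rw [abs_sub_lt_iff]
    constructor <;> linarith [hmono hs.1, hmono hs.2, hmono ht.1, hmono ht.2]
  rw [hm, add_sub_cancel_left] at h1
  have hm0 : m = 0 := by
    have : |m| < 1 := by exact_mod_cast h1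
    exact Int.abs_lt_one_iff.mp this
  rw [hm0, Int.cast_zero, add_zero] at hm
  exact (b.strictMono_psi.injective hm)

/-- Two parameters in the fundamental domain with the same point of `A` are equal. [folklore] -/
theorem eq_of_curve_A_eq {s t : ℝ} (hs : s ∈ Ico b.alo (b.alo + 1)) (ht : t ∈ Ico b.alo (b.alo + 1))
    (h : Knot.curve A s = Knot.curve A t) : s = t := by
  obtain ⟨m, hm⟩ := (Knot.curve_eq_curve_iff A).1 h
  have h1 : |(m : ℝ)| < 1 := by
    rw [show (m : ℝ) = s - t by rw [hm]; ring, abs_sub_lt_iff]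
    constructor <;> linarith [hs.1, hs.2, ht.1, ht.2]
  have hm0 : m = 0 := by
    have : |m| < 1 := by exact_mod_cast h1
    exact Int.abs_lt_one_iff.mp this
  rw [hm, hm0, Int.cast_zero, add_zero]

/-- The four kinds of parameters in the fundamental domain. [folklore] -/
theorem kind_cases (s : ℝ) :
    (s ≤ b.alo + b.epsLo ∨ b.ahi - b.epsHi ≤ s) ∨ s ∈ Icc (b.tlo - b.epsLo) (b.thi + b.epsHi) ∨
      s ∈ Ioo (b.alo + b.epsLo) (b.tlo - b.epsLo) ∨ s ∈ Ioo (b.thi + b.epsHi) (b.ahi - b.epsHi) := by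
  rcases le_or_gt s (b.alo + b.epsLo) with h1 | h1
  · exact Or.inl (Or.inl h1)
  rcases lt_or_ge s (b.tlo - b.epsLo) with h2 | h2
  · exact Or.inr (Or.inr (Or.inl ⟨h1, h2⟩))
  rcases le_or_gt s (b.thi + b.epsHi) with h3 | h3
  · exact Or.inr (Or.inl ⟨h2, h3⟩)
  rcases lt_or_ge s (b.ahi - b.epsHi) with h4 | h4
  · exact Or.inr (Or.inr (Or.inr ⟨h3, h4⟩))
  · exact Or.inl (Or.inr h4)

/-- **The piece function is injective on the fundamental domain** when the summands are disjoint.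
[folklore] -/
theorem injOn_pieceFun (hAB : Disjoint (range A) (range B)) : InjOn b.pieceFun (Ico b.alo (b.alo + 1)) := by
  have hAB' : ∀ s t, Knot.curve A s ≠ Knot.curve B t := fun s t h ↦ by
    rw [Knot.curve_apply, Knot.curve_apply] at h
    exact Set.disjoint_left.1 hAB ⟨circlePt s, rfl⟩ ⟨circlePt t, (Subtype.ext h).symm⟩
  intro s hs t ht hst
  rcases b.kind_cases s with hks | hks | hks | hks <;> rcases b.kind_cases t with hkt | hkt | hkt | hkt
  -- A / A
  · rw [b.pieceFun_typeA hs hks, b.pieceFun_typeA ht hkt] at hst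
    exact b.eq_of_curve_A_eq hs ht hst
  -- A / B
  · rw [b.pieceFun_typeA hs hks, b.pieceFun_typeB hkt] at hst
    exact absurd hst (hAB' _ _)
  -- A / O
  · obtain ⟨he, hU, h0, -, hnA, -⟩ := b.pieceFun_typeO_lo hkt
    rw [b.pieceFun_typeA hs hks, he, Knot.curve_apply] at hst
    exact absurd ⟨_, Subtype.ext hst⟩ hnA
  · obtain ⟨he, hU, h0, -, hnA, -⟩ := b.pieceFun_typeO_hi hkt
    rw [b.pieceFun_typeA hs hks, he, Knot.curve_apply] at hst
    exact absurd ⟨_, Subtype.ext hst⟩ hnA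
  -- B / A
  · rw [b.pieceFun_typeB hks, b.pieceFun_typeA ht hkt] at hst
    exact absurd hst.symm (hAB' _ _)
  -- B / B
  · rw [b.pieceFun_typeB hks, b.pieceFun_typeB hkt] at hst
    exact b.eq_of_curve_B_psi_eq hks hkt hst
  -- B / O
  · obtain ⟨he, hU, h0, -, -, hnB⟩ := b.pieceFun_typeO_lo hkt
    rw [b.pieceFun_typeB hks, he, Knot.curve_apply] at hst
    exact absurd ⟨_, Subtype.ext hst⟩ hnB
  · obtain ⟨he, hU, h0, -, -, hnB⟩ := b.pieceFun_typeO_hi hkt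
    rw [b.pieceFun_typeB hks, he, Knot.curve_apply] at hst
    exact absurd ⟨_, Subtype.ext hst⟩ hnB
  -- O_lo / A, B
  · obtain ⟨he, hU, h0, -, hnA, -⟩ := b.pieceFun_typeO_lo hks
    rw [b.pieceFun_typeA ht hkt, he, Knot.curve_apply] at hst
    exact absurd ⟨_, Subtype.ext hst.symm⟩ hnA
  · obtain ⟨he, hU, h0, -, -, hnB⟩ := b.pieceFun_typeO_lo hks
    rw [b.pieceFun_typeB hkt, he, Knot.curve_apply] at hst
    exact absurd ⟨_, Subtype.ext hst.symm⟩ hnB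
  -- O_lo / O_lo
  · obtain ⟨he, hU, -, -, -, -⟩ := b.pieceFun_typeO_lo hks
    obtain ⟨he', hU', -, -, -, -⟩ := b.pieceFun_typeO_lo hkt
    rw [he, he'] at hst
    exact b.cLo_spec.2.2.2.2.2.2.1 (b.injOn hU hU' (Subtype.ext hst))
  -- O_lo / O_hi : heights differ
  · obtain ⟨he, hU, -, h1, -, -⟩ := b.pieceFun_typeO_lo hks
    obtain ⟨he', hU', -, h1', -, -⟩ := b.pieceFun_typeO_hi hkt
    rw [he, he'] at hst
    have := congrArg (fun x : 𝔼 2 ↦ x 1) (b.injOn hU hU' (Subtype.ext hst))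
    simp only at this
    linarith
  -- O_hi / A, B
  · obtain ⟨he, hU, h0, -, hnA, -⟩ := b.pieceFun_typeO_hi hks
    rw [b.pieceFun_typeA ht hkt, he, Knot.curve_apply] at hst
    exact absurd ⟨_, Subtype.ext hst.symm⟩ hnA
  · obtain ⟨he, hU, h0, -, -, hnB⟩ := b.pieceFun_typeO_hi hks
    rw [b.pieceFun_typeB hkt, he, Knot.curve_apply] at hst
    exact absurd ⟨_, Subtype.ext hst.symm⟩ hnB
  -- O_hi / O_lo
  · obtain ⟨he, hU, -, h1, -, -⟩ := b.pieceFun_typeO_hi hks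
    obtain ⟨he', hU', -, h1', -, -⟩ := b.pieceFun_typeO_lo hkt
    rw [he, he'] at hst
    have := congrArg (fun x : 𝔼 2 ↦ x 1) (b.injOn hU hU' (Subtype.ext hst))
    simp only at this
    linarith
  -- O_hi / O_hi
  · obtain ⟨he, hU, -, -, -, -⟩ := b.pieceFun_typeO_hi hks
    obtain ⟨he', hU', -, -, -, -⟩ := b.pieceFun_typeO_hi hkt
    rw [he, he'] at hst
    exact b.injective_cUp (b.injOn hU hU' (Subtype.ext hst))

/-- **The rebuilt curve identifies parameters exactly modulo `1`** (for disjoint summands).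
[folklore] -/
theorem rebuildCurve_eq_iff (hAB : Disjoint (range A) (range B)) {s t : ℝ} :
    b.rebuildCurve s = b.rebuildCurve t ↔ ∃ m : ℤ, t - s = m := by
  constructor
  · intro h
    have : b.red s = b.red t := b.injOn_pieceFun hAB (b.red_mem s) (b.red_mem t) h
    exact b.red_eq_red_iff.1 this
  · rintro ⟨m, hm⟩
    rw [show t = s + m by linarith]
    exact ((b.periodic_rebuildCurve.int_mul m) s).symm ▸ by rw [mul_one]

/-! ### The rebuilt knot -/

/-- **The rebuilt knot** of a band-sum presentation with disjoint summands: the knot of the regular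
simple closed curve `θ ↦ rebuildCurve (θ / 2π)` (`IsRegularClosedCurve.toKnot`). [folklore] -/
def rebuild (hAB : Disjoint (range A) (range B)) : Knot :=
  b.isRegularClosedCurve_rebuildCurve.toKnot fun s t hst ↦ by
    obtain ⟨m, hm⟩ := (b.rebuildCurve_eq_iff hAB).1 hst
    have : t = s + m * (2 * π) := by
      have h := congrArg (fun x : ℝ ↦ 2 * π * x) hm
      simp only [mul_sub, ← mul_assoc, mul_inv_cancel₀ (by positivity : (2 * π : ℝ) ≠ 0), one_mul] at h
      linarith
    rw [this]
    exact (periodic_circlePoint.int_mul m s).symm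

/-- The rebuilt knot through the parameter `circlePt t`: `rebuild (circlePt t) = rebuildCurve t`
in `ℝ⁴`. [folklore] -/
theorem coe_rebuild_circlePt (hAB : Disjoint (range A) (range B)) (t : ℝ) :
    ((b.rebuild hAB (circlePt t) : 𝕊 3) : 𝔼 4) = b.rebuildCurve t := by
  rw [rebuild, circlePt_eq_circlePoint, IsRegularClosedCurve.coe_toKnot_circlePoint,
    ← mul_assoc, inv_mul_cancel₀ (by positivity : (2 * π : ℝ) ≠ 0), one_mul]

/-- The range of the rebuilt knot, read in `ℝ⁴`, is the image of the fundamental domain under the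
piece function. [folklore] -/
theorem image_coe_range_rebuild (hAB : Disjoint (range A) (range B)) :
    (Subtype.val : (𝕊 3) → 𝔼 4) '' range (b.rebuild hAB) = b.pieceFun '' Ico b.alo (b.alo + 1) := by
  rw [rebuild, IsRegularClosedCurve.image_coe_range_toKnot]
  ext p
  simp only [mem_range, mem_image]
  constructor
  · rintro ⟨θ, rfl⟩
    exact ⟨b.red ((2 * π)⁻¹ * θ), b.red_mem _, rfl⟩
  · rintro ⟨s, hs, rfl⟩
    refine ⟨2 * π * s, ?_⟩
    show b.rebuildCurve ((2 * π)⁻¹ * (2 * π * s)) = b.pieceFun s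
    rw [← mul_assoc, inv_mul_cancel₀ (by positivity : (2 * π : ℝ) ≠ 0), one_mul, rebuildCurve,
      (b.red_eq_sub (n := 0) (by simpa using hs))]
    simp

end BandCore

namespace BandCore

variable {A B : Knot} {avoid : Set (𝕊 3)} (b : BandCore A B avoid)

/-! ### The parameter stretches of the two arcs -/

/-- The lower arch climbs from height `-δ` on the left edge: a parameter `tstarLo < thetaA (3/20)`
with `fLo tstarLo = -δ`. [folklore] -/
theorem exists_tstarLo : ∃ t, t < b.thetaA (3 / 20) ∧ b.fLo t = -b.δ :=
  b.fLo_spec.2.2.2.2.1 _ (by rw [b.heightA_thetaA (by norm_num)]; linarith [b.δ_pos])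

/-- The start of the lower arc. [folklore] -/
def tstarLo : ℝ := Classical.choose b.exists_tstarLo

/-- The defining properties of `tstarLo`. [folklore] -/
theorem tstarLo_spec : b.tstarLo < b.thetaA (3 / 20) ∧ b.fLo b.tstarLo = -b.δ :=
  Classical.choose_spec b.exists_tstarLo

/-- The lower arch descends to height `-δ` on the right edge: a parameter
`tendLo > psiInv (thetaB (3/20))` with `gLo tendLo = -δ`. [folklore] -/
theorem exists_tendLo : ∃ t, b.psiInv (b.thetaB (3 / 20)) < t ∧ b.gLo t = -b.δ :=
  b.gLo_spec.2.2.2.2.1 _ (by rw [psi_psiInv, b.heightB_thetaB (by norm_num)]; linarith [b.δ_pos])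

/-- The end of the lower arc. [folklore] -/
def tendLo : ℝ := Classical.choose b.exists_tendLo

/-- The defining properties of `tendLo`. [folklore] -/
theorem tendLo_spec : b.psiInv (b.thetaB (3 / 20)) < b.tendLo ∧ b.gLo b.tendLo = -b.δ :=
  Classical.choose_spec b.exists_tendLo

/-- The upper arch starts at height `1 + δ` on the right edge: a parameter
`tstarUp < psiInv (thetaB (17/20) + 1)` with `gUp tstarUp = 1 + δ`. [folklore] -/
theorem exists_tstarUp : ∃ t, t < b.psiInv (b.thetaB (17 / 20) + 1) ∧ b.gUp t = 1 + b.δ :=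
  b.gUp_spec.2.2.2.2.1 _ (by
    rw [psi_psiInv, add_sub_cancel_right, b.heightB_thetaB (by norm_num)]; linarith [b.δ_pos])

/-- The start of the upper arc. [folklore] -/
def tstarUp : ℝ := Classical.choose b.exists_tstarUp

/-- The defining properties of `tstarUp`. [folklore] -/
theorem tstarUp_spec : b.tstarUp < b.psiInv (b.thetaB (17 / 20) + 1) ∧ b.gUp b.tstarUp = 1 + b.δ :=
  Classical.choose_spec b.exists_tstarUp

/-- The upper arch ends at height `1 + δ` on the left edge: a parameter `tendUp > thetaA (17/20)`
with `fUp tendUp = 1 + δ`. [folklore] -/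
theorem exists_tendUp : ∃ t, b.thetaA (17 / 20) < t ∧ b.fUp t = 1 + b.δ :=
  b.fUp_spec.2.2.2.2.1 _ (by rw [b.heightA_thetaA (by norm_num)]; linarith [b.δ_pos])

/-- The end of the upper arc. [folklore] -/
def tendUp : ℝ := Classical.choose b.exists_tendUp

/-- The defining properties of `tendUp`. [folklore] -/
theorem tendUp_spec : b.thetaA (17 / 20) < b.tendUp ∧ b.fUp b.tendUp = 1 + b.δ :=
  Classical.choose_spec b.exists_tendUp

/-- Order: `tstarLo < thetaA (3/20) < alo < (alo + tlo)/2 < tlo < psiInv (thetaB (3/20)) < tendLo`.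
[folklore] -/
theorem lo_order : b.tstarLo < b.thetaA (3 / 20) ∧ b.thetaA (3 / 20) < b.alo ∧
    b.alo < (b.alo + b.tlo) / 2 ∧ (b.alo + b.tlo) / 2 < b.tlo ∧ b.tlo < b.tendLo := by
  have hm := b.marks_lt
  exact ⟨b.tstarLo_spec.1, hm.2.1, by linarith, by linarith, b.tlo_marksB.1.trans b.tendLo_spec.1⟩

/-- Order: `tstarUp < psiInv (thetaB (17/20) + 1) < thi < (thi + ahi)/2 < ahi < thetaA (17/20) < tendUp`.
[folklore] -/
theorem up_order : b.tstarUp < b.thi ∧ b.thi < (b.thi + b.ahi) / 2 ∧ (b.thi + b.ahi) / 2 < b.ahi ∧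
    b.ahi < b.tendUp := by
  have hm := b.marks_lt
  exact ⟨b.tstarUp_spec.1.trans b.thi_marksB.1, by linarith, by linarith, hm.2.2.2.2.2.1.trans b.tendUp_spec.1⟩

/-! ### The reparametrisations and the arcs -/

/-- The reparametrisation of the lower arc: `[0, 1] → [tstarLo, tendLo]`, midpoint `(alo + tlo)/2`.
[folklore] -/
def rhoLo : ℝ → ℝ :=
  Classical.choose (exists_reparam (b.lo_order.1.trans (b.lo_order.2.1.trans b.lo_order.2.2.1))
    (b.lo_order.2.2.2.1.trans b.lo_order.2.2.2.2))

/-- The defining properties of `rhoLo`. [folklore] -/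
theorem rhoLo_spec : ContDiff ℝ ∞ b.rhoLo ∧ b.rhoLo 0 = b.tstarLo ∧ b.rhoLo 2⁻¹ = (b.alo + b.tlo) / 2 ∧
    b.rhoLo 1 = b.tendLo ∧ (∀ u, 0 < deriv b.rhoLo u) ∧ StrictMono b.rhoLo :=
  Classical.choose_spec (exists_reparam (b.lo_order.1.trans (b.lo_order.2.1.trans b.lo_order.2.2.1))
    (b.lo_order.2.2.2.1.trans b.lo_order.2.2.2.2))

/-- The reparametrisation of the upper arc: `[0, 1] → [tstarUp, tendUp]`, midpoint `(thi + ahi)/2`.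
[folklore] -/
def rhoUp : ℝ → ℝ :=
  Classical.choose (exists_reparam (b.up_order.1.trans b.up_order.2.1) (b.up_order.2.2.1.trans b.up_order.2.2.2))

/-- The defining properties of `rhoUp`. [folklore] -/
theorem rhoUp_spec : ContDiff ℝ ∞ b.rhoUp ∧ b.rhoUp 0 = b.tstarUp ∧ b.rhoUp 2⁻¹ = (b.thi + b.ahi) / 2 ∧
    b.rhoUp 1 = b.tendUp ∧ (∀ u, 0 < deriv b.rhoUp u) ∧ StrictMono b.rhoUp :=
  Classical.choose_spec (exists_reparam (b.up_order.1.trans b.up_order.2.1) (b.up_order.2.2.1.trans b.up_order.2.2.2))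

/-- Parameters in `(0, 1)` are carried into `(tstarLo, tendLo)`. [folklore] -/
theorem rhoLo_mem {u : ℝ} (hu : u ∈ Ioo (0 : ℝ) 1) : b.rhoLo u ∈ Ioo b.tstarLo b.tendLo := by
  obtain ⟨-, h0, -, h1, -, hm⟩ := b.rhoLo_spec
  exact ⟨h0 ▸ hm hu.1, h1 ▸ hm hu.2⟩

/-- Parameters in `(0, 1)` are carried into `(tstarUp, tendUp)`. [folklore] -/
theorem rhoUp_mem {u : ℝ} (hu : u ∈ Ioo (0 : ℝ) 1) : b.rhoUp u ∈ Ioo b.tstarUp b.tendUp := by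
  obtain ⟨-, h0, -, h1, -, hm⟩ := b.rhoUp_spec
  exact ⟨h0 ▸ hm hu.1, h1 ▸ hm hu.2⟩

/-- Every parameter of `(tstarLo, tendLo)` is `rhoLo u` for some `u ∈ (0, 1)`. [folklore] -/
theorem exists_rhoLo_eq {t : ℝ} (ht : t ∈ Ioo b.tstarLo b.tendLo) : ∃ u ∈ Ioo (0 : ℝ) 1, b.rhoLo u = t := by
  obtain ⟨hs, h0, -, h1, -, hm⟩ := b.rhoLo_spec
  obtain ⟨u, hu, hut⟩ : t ∈ b.rhoLo '' Icc 0 1 :=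
    intermediate_value_Icc zero_le_one hs.continuous.continuousOn ⟨by rw [h0]; exact ht.1.le, by rw [h1]; exact ht.2.le⟩
  refine ⟨u, ⟨lt_of_le_of_ne hu.1 ?_, lt_of_le_of_ne hu.2 ?_⟩, hut⟩
  · rintro rfl; rw [h0] at hut; exact ht.1.ne hut
  · rintro rfl; rw [h1] at hut; exact ht.2.ne' hut

/-- Every parameter of `(tstarUp, tendUp)` is `rhoUp u` for some `u ∈ (0, 1)`. [folklore] -/
theorem exists_rhoUp_eq {t : ℝ} (ht : t ∈ Ioo b.tstarUp b.tendUp) : ∃ u ∈ Ioo (0 : ℝ) 1, b.rhoUp u = t := by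
  obtain ⟨hs, h0, -, h1, -, hm⟩ := b.rhoUp_spec
  obtain ⟨u, hu, hut⟩ : t ∈ b.rhoUp '' Icc 0 1 :=
    intermediate_value_Icc zero_le_one hs.continuous.continuousOn ⟨by rw [h0]; exact ht.1.le, by rw [h1]; exact ht.2.le⟩
  refine ⟨u, ⟨lt_of_le_of_ne hu.1 ?_, lt_of_le_of_ne hu.2 ?_⟩, hut⟩
  · rintro rfl; rw [h0] at hut; exact ht.1.ne hut
  · rintro rfl; rw [h1] at hut; exact ht.2.ne' hut

/-- **The lower arc** of the rebuilt presentation. [folklore] -/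
def loArc (u : ℝ) : 𝔼 2 := b.cLo (b.rhoLo u)

/-- **The upper arc** of the rebuilt presentation. [folklore] -/
def upArc (u : ℝ) : 𝔼 2 := b.cUp (b.rhoUp u)

/-- The lower arc is `C^∞`. [folklore] -/
theorem contDiff_loArc : ContDiff ℝ ∞ b.loArc := b.cLo_spec.1.comp b.rhoLo_spec.1

/-- The upper arc is `C^∞`. [folklore] -/
theorem contDiff_upArc : ContDiff ℝ ∞ b.upArc := b.contDiff_cUp.comp b.rhoUp_spec.1

/-- The lower arc is injective. [folklore] -/
theorem injective_loArc : Injective b.loArc :=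
  b.cLo_spec.2.2.2.2.2.2.1.comp b.rhoLo_spec.2.2.2.2.2.injective

/-- The upper arc is injective. [folklore] -/
theorem injective_upArc : Injective b.upArc :=
  b.injective_cUp.comp b.rhoUp_spec.2.2.2.2.2.injective

/-- Derivative of an arch after reparametrisation: `(c ∘ ρ)' = ρ' • c' ∘ ρ`. [folklore] -/
theorem deriv_comp_reparam {c : ℝ → 𝔼 2} {ρ : ℝ → ℝ} (hc : ContDiff ℝ ∞ c) (hρ : ContDiff ℝ ∞ ρ) (u : ℝ) :
    deriv (fun u ↦ c (ρ u)) u = deriv ρ u • deriv c (ρ u) := by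
  have h := ((hc.differentiable (by simp)) (ρ u)).hasDerivAt.scomp u ((hρ.differentiable (by simp)) u).hasDerivAt
  exact h.deriv

/-- The lower arc is regular. [folklore] -/
theorem deriv_loArc_ne_zero (u : ℝ) : deriv b.loArc u ≠ 0 := by
  rw [show b.loArc = fun u ↦ b.cLo (b.rhoLo u) from rfl, deriv_comp_reparam b.cLo_spec.1 b.rhoLo_spec.1]
  exact smul_ne_zero (b.rhoLo_spec.2.2.2.2.1 u).ne' (b.cLo_spec.2.2.2.2.2.2.2 _)

/-- The upper arc is regular. [folklore] -/
theorem deriv_upArc_ne_zero (u : ℝ) : deriv b.upArc u ≠ 0 := by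
  rw [show b.upArc = fun u ↦ b.cUp (b.rhoUp u) from rfl, deriv_comp_reparam b.contDiff_cUp b.rhoUp_spec.1]
  exact smul_ne_zero (b.rhoUp_spec.2.2.2.2.1 u).ne' (b.deriv_cUp_ne_zero _)

/-- The lower arc starts at the lower-left corner `(0, -δ)`. [folklore] -/
theorem loArc_zero : b.loArc 0 = pt2 0 (-b.δ) := by
  have h := b.lo_order
  obtain ⟨hε, -, -⟩ := b.epsLo_bounds
  rw [loArc, b.rhoLo_spec.2.1, b.cLo_spec.2.1 _ (by linarith), b.tstarLo_spec.2]

/-- The lower arc ends at the lower-right corner `(1, -δ)`. [folklore] -/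
theorem loArc_one : b.loArc 1 = pt2 1 (-b.δ) := by
  have h := b.lo_order
  obtain ⟨hε, -, -⟩ := b.epsLo_bounds
  rw [loArc, b.rhoLo_spec.2.2.2.1, b.cLo_spec.2.2.1 _ (by linarith), b.tendLo_spec.2]

/-- The upper arc starts at the upper-right corner `(1, 1 + δ)`. [folklore] -/
theorem upArc_zero : b.upArc 0 = pt2 1 (1 + b.δ) := by
  have h := b.up_order
  obtain ⟨hε, -, -⟩ := b.epsHi_bounds
  rw [upArc, b.rhoUp_spec.2.1, b.cUp_eq_right (by linarith), b.tstarUp_spec.2]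

/-- The upper arc ends at the upper-left corner `(0, 1 + δ)`. [folklore] -/
theorem upArc_one : b.upArc 1 = pt2 0 (1 + b.δ) := by
  have h := b.up_order
  obtain ⟨hε, -, -⟩ := b.epsHi_bounds
  rw [upArc, b.rhoUp_spec.2.2.2.1, b.cUp_eq_left (by linarith), b.tendUp_spec.2]

/-- The midpoint of the lower arc. [folklore] -/
theorem loArc_half : b.loArc 2⁻¹ = b.cLo ((b.alo + b.tlo) / 2) := by rw [loArc, b.rhoLo_spec.2.2.1]

/-- The midpoint of the upper arc. [folklore] -/
theorem upArc_half : b.upArc 2⁻¹ = b.cUp ((b.thi + b.ahi) / 2) := by rw [upArc, b.rhoUp_spec.2.2.1]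

/-! ### Heights along the arches over their whole stretch -/

/-- `fLo` is strictly increasing on `(-∞, thetaA (17/20)]`. [folklore] -/
theorem strictMonoOn_fLo : StrictMonoOn b.fLo (Iic (b.thetaA (17 / 20))) :=
  strictMonoOn_of_deriv_pos (convex_Iic _) b.fLo_spec.1.continuous.continuousOn fun x hx ↦
    b.fLo_spec.2.2.1 x (by rw [interior_Iic] at hx; exact le_of_lt hx)

/-- `gLo` is strictly decreasing on `[psiInv (thetaB (7/20)), ∞)`. [folklore] -/
theorem strictAntiOn_gLo : StrictAntiOn b.gLo (Ici (b.psiInv (b.thetaB (7 / 20)))) :=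
  strictAntiOn_of_deriv_neg (convex_Ici _) b.gLo_spec.1.continuous.continuousOn fun x hx ↦
    b.gLo_spec.2.2.1 x (by rw [interior_Ici] at hx; exact le_of_lt hx)

/-- `fUp` is strictly increasing on `[thetaA (3/20), ∞)`. [folklore] -/
theorem strictMonoOn_fUp : StrictMonoOn b.fUp (Ici (b.thetaA (3 / 20))) :=
  strictMonoOn_of_deriv_pos (convex_Ici _) b.fUp_spec.1.continuous.continuousOn fun x hx ↦
    b.fUp_spec.2.2.1 x (by rw [interior_Ici] at hx; exact le_of_lt hx)

/-- `gUp` is strictly decreasing on `(-∞, psiInv (thetaB (13/20) + 1)]`. [folklore] -/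
theorem strictAntiOn_gUp : StrictAntiOn b.gUp (Iic (b.psiInv (b.thetaB (13 / 20) + 1))) :=
  strictAntiOn_of_deriv_neg (convex_Iic _) b.gUp_spec.1.continuous.continuousOn fun x hx ↦
    b.gUp_spec.2.2.1 x (by rw [interior_Iic] at hx; exact le_of_lt hx)

/-- **The lower arc lies in the lower half of the square neighbourhood** (away from its
endpoints): heights in `(-δ, 2/5)`. [folklore] -/
theorem cLo_mem_of_mem_Ioo {t : ℝ} (ht : t ∈ Ioo b.tstarLo b.tendLo) :
    b.cLo t ∈ squareNhd b.δ ∧ b.cLo t 1 ∈ Ioo (-b.δ) (2 / 5) := by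
  have hm := b.marks_lt
  have hδ := b.δ_pos
  obtain ⟨hε, hε1, -⟩ := b.epsLo_bounds
  have ho := b.lo_order
  have hx0 := b.cLo_spec.2.2.2.2.1 t
  -- heights
  have hx1 : b.cLo t 1 ∈ Ioo (-b.δ) (2 / 5) := by
    rcases le_or_gt t (b.alo + b.epsLo) with h1 | h1
    · -- on the left edge: `fLo t ∈ (-δ, fLo (alo + ε)]`
      rw [b.cLo_spec.2.1 t h1, pt2_apply_one]
      have hlt : b.fLo b.tstarLo < b.fLo t := b.strictMonoOn_fLo (show b.tstarLo ∈ Iic _ by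
        simp only [mem_Iic]; linarith) (show t ∈ Iic _ by simp only [mem_Iic]; linarith) ht.1
      have hle : b.fLo t ≤ b.fLo (b.alo + b.epsLo) := b.strictMonoOn_fLo.monotoneOn
        (show t ∈ Iic _ by simp only [mem_Iic]; linarith)
        (show b.alo + b.epsLo ∈ Iic _ by simp only [mem_Iic]; linarith) h1
      obtain ⟨-, hf⟩ := b.fLo_eq_heightA (t := b.alo + b.epsLo) ⟨by linarith, by linarith⟩
      rw [b.tstarLo_spec.2] at hlt
      rw [(b.fLo_eq_heightA (t := b.alo + b.epsLo) ⟨by linarith, by linarith⟩).1] at hle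
      exact ⟨hlt, by linarith [hf.2]⟩
    rcases lt_or_ge t (b.tlo - b.epsLo) with h2 | h2
    · have := (b.cLo_mem (t := t) ⟨by linarith, by linarith⟩).2
      exact ⟨by linarith [this.1], this.2⟩
    · -- on the right edge: `gLo t ∈ (-δ, gLo (tlo - ε)]`
      rw [b.cLo_spec.2.2.1 t h2, pt2_apply_one]
      have hw := b.tlo_marksB
      have hlt : b.gLo b.tendLo < b.gLo t := b.strictAntiOn_gLo (show t ∈ Ici _ by
        simp only [mem_Ici]; linarith) (show b.tendLo ∈ Ici _ by simp only [mem_Ici]; linarith) ht.2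
      have hle : b.gLo t ≤ b.gLo (b.tlo - b.epsLo) := b.strictAntiOn_gLo.antitoneOn
        (show b.tlo - b.epsLo ∈ Ici _ by simp only [mem_Ici]; linarith)
        (show t ∈ Ici _ by simp only [mem_Ici]; linarith) h2
      have hg := b.gLo_mem (show b.tlo - b.epsLo ≤ b.psiInv (b.thetaB (3 / 20)) by linarith)
      rw [b.tendLo_spec.2] at hlt
      exact ⟨hlt, by linarith [hg.2]⟩
  refine ⟨?_, hx1⟩
  rw [mem_squareNhd_iff, Fin.forall_fin_two]
  exact ⟨⟨by linarith [hx0.1], by linarith [hx0.2]⟩, ⟨hx1.1, by linarith [hx1.2]⟩⟩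

/-- **The upper arc lies in the upper half of the square neighbourhood**: heights in
`(3/5, 1 + δ)`. [folklore] -/
theorem cUp_mem_of_mem_Ioo {t : ℝ} (ht : t ∈ Ioo b.tstarUp b.tendUp) :
    b.cUp t ∈ squareNhd b.δ ∧ b.cUp t 1 ∈ Ioo (3 / 5 : ℝ) (1 + b.δ) := by
  have hm := b.marks_lt
  have hδ := b.δ_pos
  obtain ⟨hε, hε1, -⟩ := b.epsHi_bounds
  have ho := b.up_order
  have hw := b.thi_marksB
  have hx0 := b.cUp_zero_mem_Icc t
  have hx1 : b.cUp t 1 ∈ Ioo (3 / 5 : ℝ) (1 + b.δ) := by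
    rcases le_or_gt t (b.thi + b.epsHi) with h1 | h1
    · -- on the right edge: `gUp t ∈ [gUp (thi + ε), 1 + δ)`
      rw [b.cUp_eq_right h1, pt2_apply_one]
      have hlt : b.gUp t < b.gUp b.tstarUp := b.strictAntiOn_gUp (show b.tstarUp ∈ Iic _ by
        simp only [mem_Iic]; linarith [b.tstarUp_spec.1]) (show t ∈ Iic _ by simp only [mem_Iic]; linarith) ht.1
      have hge : b.gUp (b.thi + b.epsHi) ≤ b.gUp t := b.strictAntiOn_gUp.antitoneOn
        (show t ∈ Iic _ by simp only [mem_Iic]; linarith)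
        (show b.thi + b.epsHi ∈ Iic _ by simp only [mem_Iic]; linarith) h1
      have hg := b.gUp_mem (show b.psiInv (b.thetaB (17 / 20) + 1) ≤ b.thi + b.epsHi by linarith)
      rw [b.tstarUp_spec.2] at hlt
      exact ⟨by linarith [hg.1], hlt⟩
    rcases lt_or_ge t (b.ahi - b.epsHi) with h2 | h2
    · have := (b.cUp_mem (t := t) ⟨by linarith, by linarith⟩).2
      exact ⟨this.1, by linarith [this.2]⟩
    · -- on the left edge: `fUp t ∈ [fUp (ahi - ε), 1 + δ)`
      rw [b.cUp_eq_left h2, pt2_apply_one]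
      have hlt : b.fUp t < b.fUp b.tendUp := b.strictMonoOn_fUp (show t ∈ Ici _ by
        simp only [mem_Ici]; linarith) (show b.tendUp ∈ Ici _ by simp only [mem_Ici]; linarith) ht.2
      have hge : b.fUp (b.ahi - b.epsHi) ≤ b.fUp t := b.strictMonoOn_fUp.monotoneOn
        (show b.ahi - b.epsHi ∈ Ici _ by simp only [mem_Ici]; linarith)
        (show t ∈ Ici _ by simp only [mem_Ici]; linarith) h2
      obtain ⟨he, hf⟩ := b.fUp_eq_heightA (t := b.ahi - b.epsHi) ⟨by linarith, by linarith⟩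
      rw [b.tendUp_spec.2] at hlt
      rw [he] at hge
      exact ⟨by linarith [hf.1], hlt⟩
  refine ⟨?_, hx1⟩
  rw [mem_squareNhd_iff, Fin.forall_fin_two]
  exact ⟨⟨by linarith [hx0.1], by linarith [hx0.2]⟩, ⟨by linarith [hx1.1], hx1.2⟩⟩

/-- The membership clause of the lower arc. [folklore] -/
theorem loArc_mem {u : ℝ} (hu : u ∈ Ioo (0 : ℝ) 1) : b.loArc u ∈ squareNhd b.δ ∧ b.loArc u 1 < 2⁻¹ := by
  obtain ⟨h1, h2⟩ := b.cLo_mem_of_mem_Ioo (b.rhoLo_mem hu)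
  exact ⟨h1, by rw [loArc]; linarith [h2.2]⟩

/-- The membership clause of the upper arc. [folklore] -/
theorem upArc_mem {u : ℝ} (hu : u ∈ Ioo (0 : ℝ) 1) : b.upArc u ∈ squareNhd b.δ ∧ 2⁻¹ < b.upArc u 1 := by
  obtain ⟨h1, h2⟩ := b.cUp_mem_of_mem_Ioo (b.rhoUp_mem hu)
  exact ⟨h1, by rw [upArc]; linarith [h2.1]⟩

/-- The image of the lower arc is the image of the arch over its stretch. [folklore] -/
theorem image_loArc : b.loArc '' Ioo 0 1 = b.cLo '' Ioo b.tstarLo b.tendLo := by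
  ext x
  constructor
  · rintro ⟨u, hu, rfl⟩
    exact ⟨_, b.rhoLo_mem hu, rfl⟩
  · rintro ⟨t, ht, rfl⟩
    obtain ⟨u, hu, hut⟩ := b.exists_rhoLo_eq ht
    exact ⟨u, hu, by rw [loArc, hut]⟩

/-- The image of the upper arc is the image of the arch over its stretch. [folklore] -/
theorem image_upArc : b.upArc '' Ioo 0 1 = b.cUp '' Ioo b.tstarUp b.tendUp := by
  ext x
  constructor
  · rintro ⟨u, hu, rfl⟩
    exact ⟨_, b.rhoUp_mem hu, rfl⟩
  · rintro ⟨t, ht, rfl⟩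
    obtain ⟨u, hu, hut⟩ := b.exists_rhoUp_eq ht
    exact ⟨u, hu, by rw [upArc, hut]⟩

end BandCore

/-! ## Rebuilding a knot along a band core, V (`SchubertNormalForm.lean` Part V over `BandCore`) -/

namespace BandCore

variable {A B : Knot} {avoid : Set (𝕊 3)} (b : BandCore A B avoid)

/-! ### Points of the rebuilt knot -/

/-- Membership in the range of the rebuilt knot, read through the piece function. [folklore] -/
theorem mem_range_rebuild_iff (hAB : Disjoint (range A) (range B)) {p : 𝕊 3} :
    p ∈ range (b.rebuild hAB) ↔ ∃ s ∈ Ico b.alo (b.alo + 1), b.pieceFun s = (p : 𝔼 4) := by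
  have h := b.image_coe_range_rebuild hAB
  constructor
  · intro hp
    have : (p : 𝔼 4) ∈ (Subtype.val : (𝕊 3) → 𝔼 4) '' range (b.rebuild hAB) := ⟨p, hp, rfl⟩
    rw [h] at this
    exact this
  · rintro hp
    have : (p : 𝔼 4) ∈ (Subtype.val : (𝕊 3) → 𝔼 4) '' range (b.rebuild hAB) := by rw [h]; exact hp
    obtain ⟨q, hq, hqp⟩ := this
    rwa [← Subtype.ext hqp]

/-- Near a parameter of the lower arch region the rebuilt curve is `band ∘ cLo`. [folklore] -/
theorem rebuildCurve_eventuallyEq_lo {t₀ : ℝ} (h : t₀ ∈ Ioo b.alo b.tlo) :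
    b.rebuildCurve =ᶠ[𝓝 t₀] fun t ↦ ((b.band (b.cLo t) : 𝕊 3) : 𝔼 4) := by
  have hm := b.marks_lt
  filter_upwards [isOpen_Ioo.mem_nhds h] with t ht
  rw [rebuildCurve, b.red_eq_sub (n := 0) (by simpa using ⟨ht.1.le, by linarith [ht.2]⟩), Int.cast_zero,
    sub_zero, b.pieceFun_of_lt_tlo ht.2]

/-- Points of `A` with parameter in `[ahi, alo + 1]` lie on the rebuilt knot. [folklore] -/
theorem apply_A_mem_range_rebuild (hAB : Disjoint (range A) (range B)) {s : ℝ}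
    (hs : s ∈ Icc b.ahi (b.alo + 1)) : A (circlePt s) ∈ range (b.rebuild hAB) := by
  have hm := b.marks_lt
  rw [b.mem_range_rebuild_iff hAB]
  rcases hs.2.lt_or_eq with h | h
  · exact ⟨s, ⟨by linarith [hs.1], h⟩, by rw [b.pieceFun_of_ahi_le hs.1, Knot.curve_apply]⟩
  · refine ⟨b.alo, ⟨le_rfl, by linarith⟩, ?_⟩
    rw [b.pieceFun_typeA ⟨le_rfl, by linarith⟩ (Or.inl (by linarith [b.epsLo_bounds.1])), Knot.curve_apply,
      h, circlePt_add_one]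

/-- Points of `B` with parameter in `[thetaB (1/5), thetaB (4/5) + 1]` lie on the rebuilt knot.
[folklore] -/
theorem apply_B_mem_range_rebuild (hAB : Disjoint (range A) (range B)) {s : ℝ}
    (hs : s ∈ Icc (b.thetaB (1 / 5)) (b.thetaB (4 / 5) + 1)) : B (circlePt s) ∈ range (b.rebuild hAB) := by
  have hm := b.marks_lt
  obtain ⟨hε, -, -⟩ := b.epsLo_bounds
  obtain ⟨hε', -, -⟩ := b.epsHi_bounds
  rw [b.mem_range_rebuild_iff hAB]
  have h1 : b.tlo ≤ b.psiInv s := by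
    rw [← b.psiInv_psi b.tlo, psi_tlo]; exact b.strictMono_psiInv.monotone hs.1
  have h2 : b.psiInv s ≤ b.thi := by
    rw [← b.psiInv_psi b.thi, psi_thi]; exact b.strictMono_psiInv.monotone hs.2
  refine ⟨b.psiInv s, ⟨by linarith, by linarith⟩, ?_⟩
  rw [b.pieceFun_typeB ⟨by linarith, by linarith⟩, psi_psiInv, Knot.curve_apply]

/-- Reduction of a real number into a window `[a, a + 1)`. [folklore] -/
theorem exists_reduce (a x : ℝ) : ∃ (y : ℝ) (m : ℤ), y ∈ Ico a (a + 1) ∧ x = y + m :=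
  ⟨toIcoMod zero_lt_one a x, toIcoDiv zero_lt_one a x, toIcoMod_mem_Ico _ _ _, by
    have := self_sub_toIcoDiv_zsmul zero_lt_one a x
    rw [zsmul_eq_mul, mul_one] at this
    linarith⟩

/-- **Points of the band on the left edge at height `≤ 1/5` or `≥ 4/5` lie on the rebuilt knot.**
[folklore] -/
theorem band_pt2_zero_mem_range_rebuild (hAB : Disjoint (range A) (range B)) {y : ℝ}
    (hy : y ∈ Ioo (-b.δ) (1 + b.δ)) (h : y ≤ 1 / 5 ∨ 4 / 5 ≤ y) :
    b.band (pt2 0 y) ∈ range (b.rebuild hAB) := by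
  have hm := b.marks_lt
  have hmono := b.strictMonoOn_thetaA.monotoneOn
  by_cases hw : y ∈ Icc (10⁻¹ : ℝ) (9 / 10)
  · rw [← b.apply_circlePt_thetaA hw]
    rcases h with h | h
    · rw [← circlePt_add_one]
      apply b.apply_A_mem_range_rebuild hAB
      constructor
      · have : b.thetaA 10⁻¹ ≤ b.thetaA y := hmono (by norm_num) hw hw.1
        linarith
      · have : b.thetaA y ≤ b.alo := hmono hw (by norm_num) h
        linarith
    · apply b.apply_A_mem_range_rebuild hAB
      exact ⟨hmono (by norm_num) hw h, by linarith [hmono hw (by norm_num) hw.2]⟩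
  · -- off the lift window: the point of `A` has reduced parameter in `[ahi, alo + 1)`
    obtain ⟨p, hp⟩ := b.band_pt2_zero_mem (Ioo_subset_Icc_self hy)
    obtain ⟨s₀, rfl⟩ := exists_circlePt_eq p
    obtain ⟨s₁, m, hs₁, hs₀⟩ := exists_reduce b.alo s₀
    have hper : circlePt s₀ = circlePt s₁ := by rw [circlePt_eq_circlePt_iff]; exact ⟨m, hs₀⟩
    rw [hper] at hp
    rcases le_or_gt b.ahi s₁ with h1 | h1
    · rw [← hp]; exact b.apply_A_mem_range_rebuild hAB ⟨h1, hs₁.2.le⟩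
    · -- `s₁ ∈ [alo, ahi)` is inside the lift window: contradiction with `hw`
      exfalso
      have hwin : s₁ ∈ Icc (b.thetaA 10⁻¹) (b.thetaA (9 / 10)) := ⟨by linarith [hs₁.1], by linarith⟩
      have heq := b.band_pt2_zero_heightA hwin
      rw [hp] at heq
      have hU1 : pt2 0 (b.heightA s₁) ∈ squareNhd b.δ := by
        have := (b.thetaA_heightA hwin).2
        rw [pt2_mem_squareNhd_iff]
        exact ⟨⟨by linarith [b.δ_pos], by linarith [b.δ_pos]⟩, ⟨by linarith [b.δ_pos, this.1], by linarith [b.δ_pos, this.2]⟩⟩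
      have hU2 : pt2 0 y ∈ squareNhd b.δ := by
        rw [pt2_mem_squareNhd_iff]
        exact ⟨⟨by linarith [b.δ_pos], by linarith [b.δ_pos]⟩, hy⟩
      have := b.injOn hU1 hU2 heq
      have hy' : y = b.heightA s₁ := by
        have := congrArg (fun x : 𝔼 2 ↦ x 1) this; simpa using this.symm
      exact hw (hy' ▸ (b.thetaA_heightA hwin).2)

/-- **Points of the band on the right edge at height `≤ 1/5` or `≥ 4/5` lie on the rebuilt knot.**
[folklore] -/
theorem band_pt2_one_mem_range_rebuild (hAB : Disjoint (range A) (range B)) {y : ℝ}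
    (hy : y ∈ Ioo (-b.δ) (1 + b.δ)) (h : y ≤ 1 / 5 ∨ 4 / 5 ≤ y) :
    b.band (pt2 1 y) ∈ range (b.rebuild hAB) := by
  have hanti := b.strictAntiOn_thetaB
  have hmono := hanti.antitoneOn
  have hwin' := b.thetaB_window
  by_cases hw : y ∈ Icc (10⁻¹ : ℝ) (9 / 10)
  · rw [← b.apply_circlePt_thetaB hw]
    rcases h with h | h
    · apply b.apply_B_mem_range_rebuild hAB
      refine ⟨hmono hw (by norm_num) h, ?_⟩
      have h1 : b.thetaB y ≤ b.thetaB 10⁻¹ := hmono (by norm_num) hw hw.1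
      have h2 : b.thetaB (9 / 10) ≤ b.thetaB (4 / 5) := hmono (by norm_num) (by norm_num) (by norm_num)
      linarith
    · rw [← circlePt_add_one]
      apply b.apply_B_mem_range_rebuild hAB
      have h1 : b.thetaB (9 / 10) ≤ b.thetaB y := hmono hw (by norm_num) hw.2
      have h2 : b.thetaB (1 / 5) ≤ b.thetaB 10⁻¹ := hmono (by norm_num) (by norm_num) (by norm_num)
      exact ⟨by linarith, by linarith [hmono (by norm_num) hw h]⟩
  · obtain ⟨p, hp⟩ := b.band_pt2_one_mem (Ioo_subset_Icc_self hy)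
    obtain ⟨s₀, rfl⟩ := exists_circlePt_eq p
    obtain ⟨s₁, m, hs₁, hs₀⟩ := exists_reduce (b.thetaB (1 / 5)) s₀
    have hper : circlePt s₀ = circlePt s₁ := by rw [circlePt_eq_circlePt_iff]; exact ⟨m, hs₀⟩
    rw [hper] at hp
    rcases le_or_gt s₁ (b.thetaB (4 / 5) + 1) with h1 | h1
    · rw [← hp]; exact b.apply_B_mem_range_rebuild hAB ⟨hs₁.1, h1⟩
    · exfalso
      have h82 : b.thetaB (4 / 5) < b.thetaB (1 / 5) := hanti (by norm_num) (by norm_num) (by norm_num)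
      have hwin : s₁ - 1 ∈ Icc (b.thetaB (9 / 10)) (b.thetaB 10⁻¹) := by
        constructor
        · linarith [hmono (by norm_num : (4 / 5 : ℝ) ∈ Icc (10⁻¹ : ℝ) (9 / 10)) (by norm_num) (by norm_num : (4 / 5 : ℝ) ≤ 9 / 10)]
        · linarith [hs₁.2, hmono (by norm_num : (10⁻¹ : ℝ) ∈ Icc (10⁻¹ : ℝ) (9 / 10)) (by norm_num) (by norm_num : (10⁻¹ : ℝ) ≤ 1 / 5)]
      have heq := b.band_pt2_one_heightB hwin
      rw [show circlePt (s₁ - 1) = circlePt s₁ by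
        conv_rhs => rw [show s₁ = s₁ - 1 + 1 by ring, circlePt_add_one], hp] at heq
      have hh := (b.thetaB_heightB hwin).2
      have hU1 : pt2 1 (b.heightB (s₁ - 1)) ∈ squareNhd b.δ := by
        rw [pt2_mem_squareNhd_iff]
        exact ⟨⟨by linarith [b.δ_pos], by linarith [b.δ_pos]⟩, ⟨by linarith [b.δ_pos, hh.1], by linarith [b.δ_pos, hh.2]⟩⟩
      have hU2 : pt2 1 y ∈ squareNhd b.δ := by
        rw [pt2_mem_squareNhd_iff]
        exact ⟨⟨by linarith [b.δ_pos], by linarith [b.δ_pos]⟩, hy⟩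
      have := b.injOn hU1 hU2 heq
      have hy' : y = b.heightB (s₁ - 1) := by
        have := congrArg (fun x : 𝔼 2 ↦ x 1) this; simpa using this.symm
      exact hw (hy' ▸ hh)

/-! ### Band points of the rebuilt knot are arc points -/

/-- The psi-stretch `[psi (tlo - epsLo), psi (thi + epsHi)]` is shorter than one period.
[folklore] -/
theorem psi_stretch_lt_one : b.psi (b.thi + b.epsHi) - b.psi (b.tlo - b.epsLo) < 1 := by
  obtain ⟨-, -, hε2⟩ := b.epsLo_bounds
  obtain ⟨-, -, hε2'⟩ := b.epsHi_bounds
  have h37 : b.thetaB (7 / 10) < b.thetaB (3 / 10) :=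
    b.strictAntiOn_thetaB (by norm_num) (by norm_num) (by norm_num)
  have hst := b.thetaB_stretch.2
  rw [b.psi_sub_psi]
  have e : (b.thi + b.epsHi - (b.tlo - b.epsLo)) * b.lam =
      (b.thi - b.tlo) * b.lam + (b.epsLo + b.epsHi) * b.lam := by ring
  have e2 : (b.thi - b.tlo) * b.lam = b.thetaB (4 / 5) + 1 - b.thetaB (1 / 5) := by
    have := b.psi_sub_psi b.tlo b.thi
    rw [psi_thi, psi_tlo] at this
    linarith
  rw [e, e2]
  nlinarith

/-- The marks of the `B`-zone in the window of `heightB`: `psi (tlo - epsLo) ∈ [thetaB (3/10),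
thetaB (1/5)]` and `psi (thi + epsHi) - 1 ∈ [thetaB (4/5), thetaB (7/10)]`. [folklore] -/
theorem psi_zone_marks : b.psi (b.tlo - b.epsLo) ∈ Icc (b.thetaB (3 / 10)) (b.thetaB (1 / 5)) ∧
    b.psi (b.thi + b.epsHi) - 1 ∈ Icc (b.thetaB (4 / 5)) (b.thetaB (7 / 10)) := by
  obtain ⟨hε, -, hε2⟩ := b.epsLo_bounds
  obtain ⟨hε', -, hε2'⟩ := b.epsHi_bounds
  have hl := b.lam_pos
  have e1 : b.psi (b.tlo - b.epsLo) = b.thetaB (1 / 5) - b.epsLo * b.lam := by simp only [psi]; ring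
  have e2 : b.psi (b.thi + b.epsHi) = b.thetaB (4 / 5) + 1 + b.epsHi * b.lam := by
    have := b.psi_sub_psi b.thi (b.thi + b.epsHi); rw [psi_thi] at this; linarith
  rw [e1, e2]
  exact ⟨⟨by nlinarith, by nlinarith⟩, ⟨by nlinarith, by nlinarith⟩⟩

/-- **A band point of the rebuilt knot inside the collar is a point of one of the two arches**
(over their stretches). [folklore] -/
theorem mem_arches_of_band_mem_range (hAB : Disjoint (range A) (range B)) {x : 𝔼 2}
    (hx : x ∈ squareNhd b.δ) (h : b.band x ∈ range (b.rebuild hAB)) :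
    x ∈ b.cLo '' Ioo b.tstarLo b.tendLo ∪ b.cUp '' Ioo b.tstarUp b.tendUp := by
  have hm := b.marks_lt
  have hδ := b.δ_pos
  obtain ⟨hε, hε1, -⟩ := b.epsLo_bounds
  obtain ⟨hε', hε1', -⟩ := b.epsHi_bounds
  have ho := b.lo_order
  have ho' := b.up_order
  obtain ⟨s, hs, hps⟩ := (b.mem_range_rebuild_iff hAB).1 h
  have hxU := hx
  rw [mem_squareNhd_iff, Fin.forall_fin_two] at hx
  rcases b.kind_cases s with hk | hk | hk | hk
  · -- the point is on `A`: `x = (0, y)`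
    rw [b.pieceFun_typeA hs hk, Knot.curve_apply] at hps
    have hxA : x ∈ b.band ⁻¹' range A ∩ squareNhd b.δ := ⟨⟨_, Subtype.ext hps⟩, hxU⟩
    rw [b.preimage_left] at hxA
    set y := x 1 with hy
    have hxe : x = pt2 0 y := by
      ext i; fin_cases i
      · simpa using hxA.2
      · simp [hy]
    rcases le_or_gt y (b.fLo (b.alo + b.epsLo)) with h1 | h1
    · -- on the climbing part of the lower arch
      left
      obtain ⟨t, ht, hty⟩ : y ∈ b.fLo '' Icc b.tstarLo (b.alo + b.epsLo) :=
        intermediate_value_Icc (by linarith) b.fLo_spec.1.continuous.continuousOn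
          ⟨by rw [b.tstarLo_spec.2]; exact hx.2.1.le, h1⟩
      have hne : t ≠ b.tstarLo := by
        rintro rfl; rw [b.tstarLo_spec.2] at hty; linarith [hx.2.1]
      refine ⟨t, ⟨lt_of_le_of_ne ht.1 (Ne.symm hne), by linarith [ht.2]⟩, ?_⟩
      rw [b.cLo_spec.2.1 t ht.2, hty, hxe]
    rcases le_or_gt (b.fUp (b.ahi - b.epsHi)) y with h2 | h2
    · -- on the climbing part of the upper arch
      right
      obtain ⟨t, ht, hty⟩ : y ∈ b.fUp '' Icc (b.ahi - b.epsHi) b.tendUp :=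
        intermediate_value_Icc (by linarith) b.fUp_spec.1.continuous.continuousOn
          ⟨h2, by rw [b.tendUp_spec.2]; exact hx.2.2.le⟩
      have hne : t ≠ b.tendUp := by
        rintro rfl; rw [b.tendUp_spec.2] at hty; linarith [hx.2.2]
      refine ⟨t, ⟨by linarith [ht.1], lt_of_le_of_ne ht.2 hne⟩, ?_⟩
      rw [b.cUp_eq_left ht.1, hty, hxe]
    · -- in between: the parameter of `A` would lie strictly inside `(alo + ε, ahi - ε')`
      exfalso
      obtain ⟨hfl, hfl'⟩ := b.fLo_eq_heightA (t := b.alo + b.epsLo) ⟨by linarith, by linarith⟩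
      obtain ⟨hfu, hfu'⟩ := b.fUp_eq_heightA (t := b.ahi - b.epsHi) ⟨by linarith, by linarith⟩
      rw [hfl] at h1
      rw [hfu] at h2
      have hyw : y ∈ Icc (10⁻¹ : ℝ) (9 / 10) := ⟨by linarith [hfl'.1], by linarith [hfu'.2]⟩
      have hwin1 : b.alo + b.epsLo ∈ Icc (b.thetaA 10⁻¹) (b.thetaA (9 / 10)) := ⟨by linarith, by linarith⟩
      have hwin2 : b.ahi - b.epsHi ∈ Icc (b.thetaA 10⁻¹) (b.thetaA (9 / 10)) := ⟨by linarith, by linarith⟩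
      have ht1 : b.alo + b.epsLo < b.thetaA y := by
        have := b.strictMonoOn_thetaA (b.thetaA_heightA hwin1).2 hyw h1
        rwa [(b.thetaA_heightA hwin1).1] at this
      have ht2 : b.thetaA y < b.ahi - b.epsHi := by
        have := b.strictMonoOn_thetaA hyw (b.thetaA_heightA hwin2).2 h2
        rwa [(b.thetaA_heightA hwin2).1] at this
      have heq : A (circlePt (b.thetaA y)) = A (circlePt s) := by
        rw [b.apply_circlePt_thetaA hyw, ← hxe]; exact Subtype.ext hps.symm
      obtain ⟨m, hm'⟩ := circlePt_eq_circlePt_iff.1 (A.injective heq)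
      rcases lt_trichotomy m 0 with hm0 | hm0 | hm0
      · have : (m : ℝ) ≤ -1 := by exact_mod_cast Int.le_sub_one_of_lt hm0
        linarith [hs.2]
      · rw [hm0, Int.cast_zero, add_zero] at hm'
        rcases hk with hk | hk <;> linarith
      · have : (1 : ℝ) ≤ m := by exact_mod_cast hm0
        linarith [hs.1]
  · -- the point is on `B`: `x = (1, y)`
    rw [b.pieceFun_typeB hk, Knot.curve_apply] at hps
    have hxB : x ∈ b.band ⁻¹' range B ∩ squareNhd b.δ := ⟨⟨_, Subtype.ext hps⟩, hxU⟩
    rw [b.preimage_right] at hxB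
    set y := x 1 with hy
    have hxe : x = pt2 1 y := by
      ext i; fin_cases i
      · simpa using hxB.2
      · simp [hy]
    have hw := b.tlo_marksB
    have hw' := b.thi_marksB
    rcases le_or_gt y (b.gLo (b.tlo - b.epsLo)) with h1 | h1
    · -- on the descending part of the lower arch
      left
      obtain ⟨t, ht, hty⟩ : y ∈ b.gLo '' Icc (b.tlo - b.epsLo) b.tendLo :=
        intermediate_value_Icc' (by linarith) b.gLo_spec.1.continuous.continuousOn
          ⟨by rw [b.tendLo_spec.2]; exact hx.2.1.le, h1⟩
      have hne : t ≠ b.tendLo := by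
        rintro rfl; rw [b.tendLo_spec.2] at hty; linarith [hx.2.1]
      refine ⟨t, ⟨by linarith [ht.1], lt_of_le_of_ne ht.2 hne⟩, ?_⟩
      rw [b.cLo_spec.2.2.1 t ht.1, hty, hxe]
    rcases le_or_gt (b.gUp (b.thi + b.epsHi)) y with h2 | h2
    · -- on the descending part of the upper arch
      right
      obtain ⟨t, ht, hty⟩ : y ∈ b.gUp '' Icc b.tstarUp (b.thi + b.epsHi) :=
        intermediate_value_Icc' (by linarith) b.gUp_spec.1.continuous.continuousOn
          ⟨h2, by rw [b.tstarUp_spec.2]; exact hx.2.2.le⟩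
      have hne : t ≠ b.tstarUp := by
        rintro rfl; rw [b.tstarUp_spec.2] at hty; linarith [hx.2.2]
      refine ⟨t, ⟨lt_of_le_of_ne ht.1 (Ne.symm hne), by linarith [ht.2]⟩, ?_⟩
      rw [b.cUp_eq_right ht.2, hty, hxe]
    · -- in between: the parameter of `B` would lie strictly inside the stretch
      exfalso
      obtain ⟨hz1, hz2⟩ := b.psi_zone_marks
      have hg1 : b.gLo (b.tlo - b.epsLo) = b.heightB (b.psi (b.tlo - b.epsLo)) :=
        b.gLo_spec.2.1 _ ⟨hw.2, by linarith [hw.1]⟩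
      have hg2 : b.gUp (b.thi + b.epsHi) = b.heightB (b.psi (b.thi + b.epsHi) - 1) :=
        b.gUp_spec.2.1 _ ⟨by linarith [hw'.1], by linarith [hw'.2]⟩
      rw [hg1] at h1
      rw [hg2] at h2
      have hanti := b.strictAntiOn_thetaB
      have hmono := hanti.antitoneOn
      have hwin1 : b.psi (b.tlo - b.epsLo) ∈ Icc (b.thetaB (9 / 10)) (b.thetaB 10⁻¹) :=
        ⟨by linarith [hz1.1, hmono (by norm_num : (3 / 10 : ℝ) ∈ Icc (10⁻¹ : ℝ) (9 / 10)) (by norm_num) (by norm_num : (3 / 10 : ℝ) ≤ 9 / 10)],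
          by linarith [hz1.2, hmono (by norm_num : (10⁻¹ : ℝ) ∈ Icc (10⁻¹ : ℝ) (9 / 10)) (by norm_num) (by norm_num : (10⁻¹ : ℝ) ≤ 1 / 5)]⟩
      have hwin2 : b.psi (b.thi + b.epsHi) - 1 ∈ Icc (b.thetaB (9 / 10)) (b.thetaB 10⁻¹) :=
        ⟨by linarith [hz2.1, hmono (by norm_num : (4 / 5 : ℝ) ∈ Icc (10⁻¹ : ℝ) (9 / 10)) (by norm_num) (by norm_num : (4 / 5 : ℝ) ≤ 9 / 10)],
          by linarith [hz2.2, hmono (by norm_num : (10⁻¹ : ℝ) ∈ Icc (10⁻¹ : ℝ) (9 / 10)) (by norm_num) (by norm_num : (10⁻¹ : ℝ) ≤ 7 / 10)]⟩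
      obtain ⟨e1, hh1⟩ := b.thetaB_heightB hwin1
      obtain ⟨e2, hh2⟩ := b.thetaB_heightB hwin2
      -- `heightB` of the zone marks lies in `[1/5, 3/10]` resp. `[7/10, 4/5]`
      have hb1 : (1 / 5 : ℝ) ≤ b.heightB (b.psi (b.tlo - b.epsLo)) := by
        rw [← b.heightB_thetaB (y := 1 / 5) (by norm_num)]
        exact b.strictAntiOn_heightB.antitoneOn hwin1 ⟨by linarith [hanti (by norm_num) (by norm_num) (by norm_num : (1 / 5 : ℝ) < 9 / 10)], hmono (by norm_num) (by norm_num) (by norm_num : (10⁻¹ : ℝ) ≤ 1 / 5)⟩ hz1.2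
      have hb2 : b.heightB (b.psi (b.thi + b.epsHi) - 1) ≤ 4 / 5 := by
        rw [← b.heightB_thetaB (y := 4 / 5) (by norm_num)]
        exact b.strictAntiOn_heightB.antitoneOn ⟨hmono (by norm_num) (by norm_num) (by norm_num : (4 / 5 : ℝ) ≤ 9 / 10), by linarith [hanti (by norm_num) (by norm_num) (by norm_num : (10⁻¹ : ℝ) < 4 / 5)]⟩ hwin2 hz2.1
      have hyw : y ∈ Icc (10⁻¹ : ℝ) (9 / 10) := ⟨by linarith, by linarith⟩
      have ht1 : b.thetaB y < b.psi (b.tlo - b.epsLo) := by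
        have := hanti hh1 hyw h1; rwa [e1] at this
      have ht2 : b.psi (b.thi + b.epsHi) - 1 < b.thetaB y := by
        have := hanti hyw hh2 h2; rwa [e2] at this
      have heq : B (circlePt (b.thetaB y)) = B (circlePt (b.psi s)) := by
        rw [b.apply_circlePt_thetaB hyw, ← hxe]; exact Subtype.ext hps.symm
      obtain ⟨m, hm'⟩ := circlePt_eq_circlePt_iff.1 (B.injective heq)
      have hps1 := b.strictMono_psi.monotone hk.1
      have hps2 := b.strictMono_psi.monotone hk.2
      have hL := b.psi_stretch_lt_one
      rcases lt_trichotomy m 0 with hm0 | hm0 | hm0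
      · have : (m : ℝ) ≤ -1 := by exact_mod_cast Int.le_sub_one_of_lt hm0
        nlinarith
      · rw [hm0, Int.cast_zero, add_zero] at hm'
        linarith
      · have : (1 : ℝ) ≤ m := by exact_mod_cast hm0
        linarith
  · -- a band point of the lower arch
    left
    obtain ⟨he, hU, -, -, -, -⟩ := b.pieceFun_typeO_lo hk
    rw [he] at hps
    have := b.injOn hU hxU (Subtype.ext hps)
    exact ⟨s, ⟨by linarith [hk.1], by linarith [hk.2]⟩, this⟩
  · -- a band point of the upper arch
    right
    obtain ⟨he, hU, -, -, -, -⟩ := b.pieceFun_typeO_hi hk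
    rw [he] at hps
    have := b.injOn hU hxU (Subtype.ext hps)
    exact ⟨s, ⟨by linarith [hk.1], by linarith [hk.2]⟩, this⟩

/-- **Every point of the lower arch over its stretch is a band point of the rebuilt knot.**
[folklore] -/
theorem band_cLo_mem_range (hAB : Disjoint (range A) (range B)) {t : ℝ} (ht : t ∈ Ioo b.tstarLo b.tendLo) :
    b.band (b.cLo t) ∈ range (b.rebuild hAB) := by
  have hm := b.marks_lt
  obtain ⟨hε, hε1, -⟩ := b.epsLo_bounds
  have ho := b.lo_order
  obtain ⟨hU, hx1⟩ := b.cLo_mem_of_mem_Ioo ht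
  rcases lt_or_ge t b.alo with h1 | h1
  · -- climbing part: a point of the left edge at height `< 1/5`
    have hform := b.cLo_spec.2.1 t (by linarith)
    rw [hform]
    rw [hform, pt2_apply_one] at hx1
    apply b.band_pt2_zero_mem_range_rebuild hAB ⟨hx1.1, by linarith [hx1.2, b.δ_pos]⟩
    left
    have := b.strictMonoOn_fLo (show t ∈ Iic _ by simp only [mem_Iic]; linarith)
      (show b.alo ∈ Iic _ by simp only [mem_Iic]; linarith) h1
    rw [(b.fLo_eq_heightA (t := b.alo) ⟨by linarith, by linarith⟩).1, b.heightA_marks.1] at this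
    exact this.le
  rcases lt_or_ge t b.tlo with h2 | h2
  · rw [b.mem_range_rebuild_iff hAB]
    exact ⟨t, ⟨h1, by linarith⟩, b.pieceFun_of_lt_tlo h2⟩
  · -- descending part: a point of the right edge at height `≤ 1/5`
    have hform := b.cLo_spec.2.2.1 t (by linarith)
    rw [hform]
    rw [hform, pt2_apply_one] at hx1
    apply b.band_pt2_one_mem_range_rebuild hAB ⟨hx1.1, by linarith [hx1.2, b.δ_pos]⟩
    left
    have hw := b.tlo_marksB
    have := b.strictAntiOn_gLo.antitoneOn (show b.tlo ∈ Ici _ by simp only [mem_Ici]; linarith)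
      (show t ∈ Ici _ by simp only [mem_Ici]; linarith) h2
    rw [b.gLo_spec.2.1 b.tlo ⟨by linarith [hw.2], hw.1.le⟩, psi_tlo, b.heightB_thetaB (by norm_num)] at this
    exact this

/-- **Every point of the upper arch over its stretch is a band point of the rebuilt knot.**
[folklore] -/
theorem band_cUp_mem_range (hAB : Disjoint (range A) (range B)) {t : ℝ} (ht : t ∈ Ioo b.tstarUp b.tendUp) :
    b.band (b.cUp t) ∈ range (b.rebuild hAB) := by
  have hm := b.marks_lt
  obtain ⟨hε, hε1, -⟩ := b.epsHi_bounds
  have ho := b.up_order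
  have hw := b.thi_marksB
  obtain ⟨hU, hx1⟩ := b.cUp_mem_of_mem_Ioo ht
  rcases le_or_gt t b.thi with h1 | h1
  · -- descending part near `B`: a point of the right edge at height `≥ 4/5`
    have hform := b.cUp_eq_right (t := t) (by linarith)
    rw [hform]
    rw [hform, pt2_apply_one] at hx1
    apply b.band_pt2_one_mem_range_rebuild hAB ⟨by linarith [hx1.1, b.δ_pos], hx1.2⟩
    right
    have := b.strictAntiOn_gUp.antitoneOn (show t ∈ Iic _ by simp only [mem_Iic]; linarith)
      (show b.thi ∈ Iic _ by simp only [mem_Iic]; linarith) h1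
    rw [b.gUp_spec.2.1 b.thi ⟨hw.1.le, by linarith [hw.2]⟩, psi_thi, add_sub_cancel_right,
      b.heightB_thetaB (by norm_num)] at this
    exact this
  rcases lt_or_ge t b.ahi with h2 | h2
  · rw [b.mem_range_rebuild_iff hAB]
    exact ⟨t, ⟨by linarith, by linarith⟩, b.pieceFun_of_thi_le h1.le h2⟩
  · -- climbing part near `A`: a point of the left edge at height `≥ 4/5`
    have hform := b.cUp_eq_left (t := t) (by linarith)
    rw [hform]
    rw [hform, pt2_apply_one] at hx1
    apply b.band_pt2_zero_mem_range_rebuild hAB ⟨by linarith [hx1.1, b.δ_pos], hx1.2⟩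
    right
    have := b.strictMonoOn_fUp.monotoneOn (show b.ahi ∈ Ici _ by simp only [mem_Ici]; linarith)
      (show t ∈ Ici _ by simp only [mem_Ici]; linarith) h2
    rw [(b.fUp_eq_heightA (t := b.ahi) ⟨by linarith, by linarith⟩).1, b.heightA_marks.2.2.2] at this
    exact this

/-- **The range clause** of the rebuilt presentation. [folklore] -/
theorem preimage_range_rebuild (hAB : Disjoint (range A) (range B)) :
    b.band ⁻¹' range (b.rebuild hAB) ∩ squareNhd b.δ = b.loArc '' Ioo 0 1 ∪ b.upArc '' Ioo 0 1 := by
  rw [image_loArc, image_upArc]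
  ext x
  constructor
  · rintro ⟨hx, hU⟩
    exact b.mem_arches_of_band_mem_range hAB hU hx
  · rintro (⟨t, ht, rfl⟩ | ⟨t, ht, rfl⟩)
    · exact ⟨b.band_cLo_mem_range hAB ht, (b.cLo_mem_of_mem_Ioo ht).1⟩
    · exact ⟨b.band_cUp_mem_range hAB ht, (b.cUp_mem_of_mem_Ioo ht).1⟩

/-- **The complement clause**: off the band the rebuilt knot is `A ∪ B`. [folklore] -/
theorem range_diff_rebuild (hAB : Disjoint (range A) (range B)) :
    range (b.rebuild hAB) \ b.band '' squareNhd b.δ = (range A ∪ range B) \ b.band '' squareNhd b.δ := by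
  have hm := b.marks_lt
  have hδ := b.δ_pos
  ext p
  simp only [Set.mem_sdiff, mem_union]
  constructor
  · rintro ⟨hp, hnot⟩
    refine ⟨?_, hnot⟩
    obtain ⟨s, hs, hps⟩ := (b.mem_range_rebuild_iff hAB).1 hp
    rcases b.kind_cases s with hk | hk | hk | hk
    · rw [b.pieceFun_typeA hs hk, Knot.curve_apply] at hps
      exact Or.inl ⟨_, Subtype.ext hps⟩
    · rw [b.pieceFun_typeB hk, Knot.curve_apply] at hps
      exact Or.inr ⟨_, Subtype.ext hps⟩
    · obtain ⟨he, hU, -, -, -, -⟩ := b.pieceFun_typeO_lo hk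
      rw [he] at hps
      exact absurd ⟨_, hU, Subtype.ext hps⟩ hnot
    · obtain ⟨he, hU, -, -, -, -⟩ := b.pieceFun_typeO_hi hk
      rw [he] at hps
      exact absurd ⟨_, hU, Subtype.ext hps⟩ hnot
  · rintro ⟨hp | hp, hnot⟩ <;> refine ⟨?_, hnot⟩
    · obtain ⟨q, rfl⟩ := hp
      obtain ⟨s₀, rfl⟩ := exists_circlePt_eq q
      obtain ⟨s₁, m, hs₁, hs₀⟩ := exists_reduce b.alo s₀
      have hper : circlePt s₀ = circlePt s₁ := by rw [circlePt_eq_circlePt_iff]; exact ⟨m, hs₀⟩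
      rw [hper] at hnot ⊢
      rcases le_or_gt b.ahi s₁ with h1 | h1
      · exact b.apply_A_mem_range_rebuild hAB ⟨h1, hs₁.2.le⟩
      · exfalso
        have hwin : s₁ ∈ Icc (b.thetaA 10⁻¹) (b.thetaA (9 / 10)) := ⟨by linarith [hs₁.1], by linarith⟩
        have hh := (b.thetaA_heightA hwin).2
        refine hnot ⟨pt2 0 (b.heightA s₁), ?_, b.band_pt2_zero_heightA hwin⟩
        rw [pt2_mem_squareNhd_iff]
        exact ⟨⟨by linarith, by linarith⟩, ⟨by linarith [hh.1], by linarith [hh.2]⟩⟩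
    · obtain ⟨q, rfl⟩ := hp
      obtain ⟨s₀, rfl⟩ := exists_circlePt_eq q
      obtain ⟨s₁, m, hs₁, hs₀⟩ := exists_reduce (b.thetaB (1 / 5)) s₀
      have hper : circlePt s₀ = circlePt s₁ := by rw [circlePt_eq_circlePt_iff]; exact ⟨m, hs₀⟩
      rw [hper] at hnot ⊢
      have hanti := b.strictAntiOn_thetaB
      have hmono := hanti.antitoneOn
      rcases le_or_gt s₁ (b.thetaB (4 / 5) + 1) with h1 | h1
      · exact b.apply_B_mem_range_rebuild hAB ⟨hs₁.1, h1⟩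
      · exfalso
        have hwin : s₁ - 1 ∈ Icc (b.thetaB (9 / 10)) (b.thetaB 10⁻¹) := by
          constructor
          · linarith [hmono (by norm_num : (4 / 5 : ℝ) ∈ Icc (10⁻¹ : ℝ) (9 / 10)) (by norm_num) (by norm_num : (4 / 5 : ℝ) ≤ 9 / 10)]
          · linarith [hs₁.2, hmono (by norm_num : (10⁻¹ : ℝ) ∈ Icc (10⁻¹ : ℝ) (9 / 10)) (by norm_num) (by norm_num : (10⁻¹ : ℝ) ≤ 1 / 5)]
        have hh := (b.thetaB_heightB hwin).2
        refine hnot ⟨pt2 1 (b.heightB (s₁ - 1)), ?_, ?_⟩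
        · rw [pt2_mem_squareNhd_iff]
          exact ⟨⟨by linarith, by linarith⟩, ⟨by linarith [hh.1], by linarith [hh.2]⟩⟩
        · rw [b.band_pt2_one_heightB hwin]
          conv_rhs => rw [show s₁ = s₁ - 1 + 1 by ring, circlePt_add_one]

/-! ### The orientation clause along the lower arc -/

/-- **Orientation of the rebuilt knot along the lower arc**: at the midpoint `loArc (1/2) =
cLo ((alo + tlo)/2)` the rebuilt knot is parametrised by `band ∘ cLo` itself (up to the positive
factors `2π` and `rhoLo' (1/2)`). [folklore] -/
theorem orient_result_rebuild (hAB : Disjoint (range A) (range B)) :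
    ∃ θ c : ℝ, 0 < c ∧ b.rebuild hAB (circlePoint θ) = b.band (b.loArc 2⁻¹) ∧
      deriv (fun t ↦ ((b.rebuild hAB (circlePoint t) : 𝕊 3) : 𝔼 4)) θ =
        c • fderiv ℝ (fun x ↦ ((b.band x : 𝕊 3) : 𝔼 4)) (b.loArc 2⁻¹) (deriv b.loArc 2⁻¹) := by
  have ho := b.lo_order
  set tm := (b.alo + b.tlo) / 2 with htm
  have htm' : tm ∈ Ioo b.alo b.tlo := ⟨ho.2.2.1, ho.2.2.2.1⟩
  have hρ := b.rhoLo_spec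
  set r := deriv b.rhoLo 2⁻¹ with hr
  have hrpos : 0 < r := hρ.2.2.2.2.1 _
  refine ⟨2 * π * tm, ((2 * π)⁻¹) * r⁻¹, mul_pos (inv_pos.2 (by positivity)) (inv_pos.2 hrpos), ?_, ?_⟩
  · apply Subtype.ext
    rw [← circlePt_eq_circlePoint, b.coe_rebuild_circlePt, loArc_half,
      (b.rebuildCurve_eventuallyEq_lo htm').self_of_nhds]
  · -- the knot through `circlePoint` is the rebuilt curve at `t / 2π`
    have hfun : (fun t ↦ ((b.rebuild hAB (circlePoint t) : 𝕊 3) : 𝔼 4)) =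
        fun t ↦ b.rebuildCurve ((2 * π)⁻¹ * t) := by
      funext t
      rw [rebuild, IsRegularClosedCurve.coe_toKnot_circlePoint]
    rw [hfun, deriv_comp_mul_left (2 * π)⁻¹ b.rebuildCurve, ← mul_assoc,
      inv_mul_cancel₀ (by positivity : (2 * π : ℝ) ≠ 0), one_mul]
    -- derivative of the rebuilt curve at `tm` through the local representation
    rw [(b.rebuildCurve_eventuallyEq_lo htm').deriv_eq]
    have hband : HasDerivAt (fun t ↦ ((b.band (b.cLo t) : 𝕊 3) : 𝔼 4))
        (fderiv ℝ (fun x ↦ ((b.band x : 𝕊 3) : 𝔼 4)) (b.cLo tm) (deriv b.cLo tm)) tm :=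
      ((b.contDiff_coe_band.differentiable (by simp)) _).hasFDerivAt.comp_hasDerivAt tm
        ((b.cLo_spec.1.differentiable (by simp)) _).hasDerivAt
    rw [hband.deriv, loArc_half, show b.loArc = fun u ↦ b.cLo (b.rhoLo u) from rfl,
      deriv_comp_reparam b.cLo_spec.1 hρ.1, hρ.2.2.1, map_smul, smul_smul, ← hr,
      mul_assoc, inv_mul_cancel₀ hrpos.ne', mul_one]

/-! ### The rebuilt presentation -/

/-- **The rebuilt knot is a band sum of `A` and `B` along the same band, with the same collar
width, and the standard arcs.** [folklore] -/
def rebuildData (b : BandCore A B avoid) (hAB : Disjoint (range A) (range B)) :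
    BandData A B (b.rebuild hAB) avoid where
  band := b.band
  δ := b.δ
  δ_pos := b.δ_pos
  contMDiff := b.contMDiff
  injOn := b.injOn
  injective_mfderiv := b.injective_mfderiv
  disjoint_avoid := b.disjoint_avoid
  preimage_left := b.preimage_left
  preimage_right := b.preimage_right
  range_diff := b.range_diff_rebuild hAB
  lowerArc := b.loArc
  upperArc := b.upArc
  contDiff_lowerArc := b.contDiff_loArc
  contDiff_upperArc := b.contDiff_upArc
  injOn_lowerArc := b.injective_loArc.injOn
  injOn_upperArc := b.injective_upArc.injOn
  deriv_lowerArc_ne_zero t _ := b.deriv_loArc_ne_zero t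
  deriv_upperArc_ne_zero t _ := b.deriv_upArc_ne_zero t
  lowerArc_zero := b.loArc_zero
  lowerArc_one := b.loArc_one
  upperArc_zero := b.upArc_zero
  upperArc_one := b.upArc_one
  lowerArc_mem _ ht := b.loArc_mem ht
  upperArc_mem _ ht := b.upArc_mem ht
  preimage_range := b.preimage_range_rebuild hAB
  orient_left := b.orient_left
  orient_right := b.orient_right
  orient_result := b.orient_result_rebuild hAB

/-- The rebuilt presentation has the same band. [folklore] -/
@[simp] theorem rebuildData_band (b : BandCore A B avoid) (hAB : Disjoint (range A) (range B)) :
    (b.rebuildData hAB).band = b.band := rfl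

/-- The rebuilt presentation has the same collar width. [folklore] -/
@[simp] theorem rebuildData_δ (b : BandCore A B avoid) (hAB : Disjoint (range A) (range B)) :
    (b.rebuildData hAB).δ = b.δ := rfl

/-! ### Every band core is the band of a band sum -/

/-- **The rebuilt knot is a band sum along the core.** [folklore] -/
theorem isBandSum_rebuild (b : BandCore A B avoid) (hAB : Disjoint (range A) (range B)) :
    Knot.IsBandSum A B (b.rebuild hAB) avoid :=
  ⟨b.rebuildData hAB⟩

/-- **Every band core between disjoint knots is the band of a band sum**: for a band core
`b : BandCore A B avoid` with `A`, `B` disjoint there is a knot `K` (the rebuilt knot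
`b.rebuild hAB`) with `Knot.IsBandSum A B K avoid`, presented along the band of `b` with the same
collar width. Gompf–Stipsicz (1999), §5.1, Fig. 5.7; Kirby (1989), Ch. I §4, p. 10.
[cite: GompfStipsicz1999, §5.1] -/
theorem exists_isBandSum (b : BandCore A B avoid) (hAB : Disjoint (range A) (range B)) :
    ∃ K : Knot, Knot.IsBandSum A B K avoid :=
  ⟨b.rebuild hAB, b.isBandSum_rebuild hAB⟩

end BandCore

/-! ### Pre-band data are band cores -/

namespace PreBandData

variable {A B : Knot} {avoid : Set (𝕊 3)}

/-- Pre-band data (`PreBandData.lean`) are a band core: the two structures have the same eleven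
fields. [folklore] -/
def toCore (b : PreBandData A B avoid) : BandCore A B avoid where
  band := b.band
  δ := b.δ
  δ_pos := b.δ_pos
  contMDiff := b.contMDiff
  injOn := b.injOn
  injective_mfderiv := b.injective_mfderiv
  disjoint_avoid := b.disjoint_avoid
  preimage_left := b.preimage_left
  preimage_right := b.preimage_right
  orient_left := b.orient_left
  orient_right := b.orient_right

/-- `toCore` keeps the band. [folklore] -/
@[simp] theorem toCore_band (b : PreBandData A B avoid) : b.toCore.band = b.band := rfl

/-- `toCore` keeps the collar width. [folklore] -/
@[simp] theorem toCore_δ (b : PreBandData A B avoid) : b.toCore.δ = b.δ := rfl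

/-- **Pre-band data between disjoint knots are the band of a band sum** (through
`BandCore.exists_isBandSum`). Gompf–Stipsicz (1999), §5.1, Fig. 5.7.
[cite: GompfStipsicz1999, §5.1] -/
theorem exists_isBandSum (b : PreBandData A B avoid) (hAB : Disjoint (range A) (range B)) :
    ∃ K : Knot, Knot.IsBandSum A B K avoid :=
  b.toCore.exists_isBandSum hAB

end PreBandData

end Literature.Topology.FourManifolds
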